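import Literature.MathematicalPhysics.QuantumFieldTheory.Balaban1983to89.B4Lemma22Reduce231
import Literature.MathematicalPhysics.QuantumFieldTheory.Balaban1983to89.B4Lemma22ZeroBoxDerivDual
import Literature.MathematicalPhysics.QuantumFieldTheory.Balaban1983to89.B4Cor23Zero

/-!
# B4 p. 581–582, proof of Lemma 2.2 — the hypotheses of the (2.31)–(2.33) reduction DISCHARGED

… at `A₀ = 0` and at constant configurations `A₀`, on boxes, for the clauses `q = p = ∞` (and `1`), `n = 0,1`;
and (§7) the bound for [B4]'s `G_k(□,Ã)` itself, `Ã = A₀ + A′`, ONE HYPOTHESIS AWAY (first-order smallness of `V`).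

T. Bałaban, *Regularity and decay of lattice Green's functions*, Commun. Math. Phys. **89** (1983) 571–597 (= B4),
p. 581 [PDF 11] (transcript `HOME/b2b-balaban-b04/transcript-B4.md` ll. 157–167), verbatim:
«Let us assume that Lemma 2.2 holds for G_k(□,A₀) with constant configurations A₀. We will prove it for a general
case using (2.31).» … «(2.33) … The series on the right hand side is convergent for e sufficiently small, and we get
the inequality (2.16). The inequality (2.17) is proved in the same way.»
«Lemma 2.2 in the case of a constant configuration A₀ is equivalent to the case of configuration A₀ = 0 by the same
argument with the gauge transformation as before. Thus we have reduced the proof of this lemma to a proof of the»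
p. 582 [PDF 12] (l. 170): «corresponding properties for the propagator G_k(□,0), or to the one-component propagator
G_k(□) [G_k(□,0) = G_k(□)1, 1 is identity operator on R^N].»
Lemma 2.2 itself, pp. 577–578 [PDF 7–8] (ll. 104–110): «Then for e sufficiently small and α < 1, there exists a
constant c₁ depending on d, α only, such that (2.16) ‖G_k(□,Ã)f‖_{1,α} ≤ c₁‖f‖_∞,» «and a constant c₂ depending on
d, p₁, such that (2.17) ‖G_k(□,Ã)f‖_q, ‖D^η_{Ã,μ}G_k(□,Ã)f‖_q, ‖G_k(□,Ã)D^{η*}_{Ã,μ}f‖_q ≤ c₂‖f‖_p for 1 ≤ p, q ≤ ∞,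
satisfying the condition 1/p − 1/p₁ ≤ 1/q ≤ 1/p with p₁ > d.»

## What is certified here (HONEST SCOPE)

The tree module `B4Lemma22Reduce231` (this lineage, node 8) proves the INFERENCE (2.31)–(2.33) in operator form:
`reduce_sup` — IF the unperturbed Green's function `G₀ = G_k(□,A₀)` obeys the (2.17)-type bounds
`‖G₀Φ‖_∞ ≤ c‖Φ‖_∞`, `‖D_μG₀Φ‖_∞ ≤ c‖Φ‖_∞` (mixed sup norm `supN` of `N`-component fields) and the perturbation `V`
is «a first order differential operator with small coefficients» (`FirstOrderSmall supN V D ε`, `(m+1)cε ≤ 1/2`),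
THEN `G = G₀ + G₀VG` obeys the same bounds.  Its two `A₀`-hypotheses were left abstract there.

THIS MODULE DISCHARGES THEM AT `A₀ = 0` ON BOXES from theorems ALREADY IN THE TREE — the zero-field Lemma 2.2 at
`p = q = ∞` and `p = q = 1`, `n = 0,1`, for the scalar («one-component») propagator `G_k(□)`:
`B4Thm110ZeroBox.lemma22_zero_box_rowSum` / `_colSum` (`Σ_{x'}|G_k(□)(x,x')| ≤ c₀`),
`B4Thm110ZeroBoxDeriv.lemma22_zero_box_deriv_rowSum` and `B4Lemma22ZeroBoxDerivDual.lemma22_zero_box_deriv_colSum`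
(`Σ_{x'}|η^{-1}(G_k(□)(x+ηe_μ,x') − G_k(□)(x,x'))| ≤ c₀`), uniformly over the window `k ≥ 1`, `a ∈ [a₋,a₊]`,
`m² ∈ [0,m²₊]`, all boxes `□ = {0 ≤ x_μ < L^kM_μ}` — via the printed identification «G_k(□,0) = G_k(□)1, 1 is
identity operator on R^N»: the `N`-component operator is the Kronecker product `G_k(□) ⊗ 1_ι`
(`B4GaugeCovariance.blockOp_smul_one`; cf. `B4GaugeCovariance.b4Op_zero … = scalarOp … ⊗ₖ 1`).

* §1 (generic, any finite site sets `X, Y`, colours `ι`): the LIFT of scalar kernel bounds to the mixed norms of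
  `B4Lemma22Reduce231` — `fld_kron_mulVec` (`((S ⊗ 1)Φ)(y) = Σ_x S(y,x)φ(x)`), `siteNorm_sum_le`,
  `supN_kron_le` (row sums `Σ_x|S(y,x)| ≤ B` ⇒ `‖(S⊗1)Φ‖_∞ ≤ B‖Φ‖_∞`), `l1N_kron_le` (column sums ⇒ `ℓ¹` bound),
  `kron_mulVec_kron_mulVec` (`(T⊗1)(S⊗1)Φ = (TS⊗1)Φ`), `kron_one_isUnit_det`.
* §2 (scalar lattice calculus on a region `R ⊂ ℤ^{d+1}`, mesh `η = 1/n`): the kernel of `D^η_μ ∘ G` as the matrix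
  product `fdiffM n R μ * G` (`B4Cor23Zero.fdiffM`, Neumann convention (1.3): no bond, no difference) —
  `fdiffM_mul_apply`, `_of_mem`, `_of_not_mem`, `_fwd`, and `rowSum_fdiffM_mul_le`.
* §3 THE ZERO-FIELD HYPOTHESES: `zero_box_sup` — `∃ c > 0` (uniform over the window) with
  `‖(G_k(□)⊗1)Φ‖_∞ ≤ c‖Φ‖_∞` and `‖(D^η_μ⊗1)(G_k(□)⊗1)Φ‖_∞ ≤ c‖Φ‖_∞` for every `N`-component `Φ` and every `μ`;
  `zero_box_l1` — the same in the dual norm `‖·‖₁`.  These are exactly the hypotheses `h0`, `hD` of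
  `B4Lemma22Reduce231.reduce_sup` / `reduce_l1` for `G₀ = G_k(□,0)`, `D_μ = D^η_{0,μ}`.
* §4 HEADLINES AT `A₀ = 0` (kernel-certified instances of the printed inference with its `A₀ = 0` hypotheses
  discharged): `lemma22_17_sup` — for EVERY perturbation `V` that is first-order small in `‖·‖_∞` w.r.t. the
  zero-field derivatives with `(d+2)cε ≤ 1/2` and every `G` with `G = G_k(□,0)⊗1 + (G_k(□,0)⊗1)VG`:
  `‖GΦ‖_∞ + Σ_μ‖(D^η_μ⊗1)GΦ‖_∞ ≤ 2(d+2)c‖Φ‖_∞` ((2.17), `q = p = ∞`, `n = 0,1`); `lemma22_17_sup_inv` — the same for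
  `G = (H_k(□)⊗1 − V)^{-1}` (`H_k(□) = B4BoxCov237.boxOpR`, invertibility of `H − V` as hypothesis);
  `lemma22_17_l1` (the `ℓ¹` instance); `lemma22_17_dual` (the clause `G(D^η_μ⊗1)^⊤` at `q = ∞` for symmetric `G`,
  via `B4Lemma22Reduce231.bootstrap_dual`); `lemma22_16_transfer` ((2.33)/(2.16)-shape: any subadditive functional
  `N` bounded on `G_k(□,0)⊗1` by `c₁‖·‖_∞` is bounded on `G` by `2c₁‖·‖_∞`); and the `V = 0` instance
  `lemma22_17_sup_zeroField` ((2.17)_∞, `n = 0,1`, for the `N`-component zero-field propagator itself —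
  non-vacuity of the hypotheses and the vector form of the tree's scalar theorems).
* §5 «by the same argument with the gauge transformation» (generic): the mixed norms are GAUGE INVARIANT
  (`supN_gauge`, `l1N_gauge`, `…_transpose`; `isGauge_transpose`) and the bootstrap hypotheses pass from
  `(G₀, D_μ)` to the conjugates `(𝒢G₀𝒢ᵀ, 𝒢D_μ𝒢ᵀ)` with the same constant (`hyps_conj`, `sup_hyps_conj`,
  `l1_hyps_conj`; `conj_mul_conj`).
* §6 THE CONSTANT CONFIGURATION `A₀`: `covDeriv_one` (`D^η_{0,μ} = D^η_μ ⊗ 1` for the lineage's covariant derivative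
  `B4Lemma21Region.covDeriv`), `dirKer_gaugeKer` / `covDeriv_gauge` (GAUGE COVARIANCE OF THE COVARIANT DERIVATIVE,
  `D_{gWgᵀ} = 𝒢D_W𝒢ᵀ`), `covDeriv_constBond` (`D^η_{A₀,μ} = 𝒢(D^η_μ⊗1)𝒢ᵀ` with the linear gauge of
  `B4GaugeCovariance.fieldLink_constBond`); `const_box_sup` — **«Lemma 2.2 holds for G_k(□,A₀) with constant
  configurations A₀» PROVED for the clauses `q = p = ∞`, `n = 0,1`, on boxes**, for [B4]'s Green's function (1.6)
  of the lineage's operator family `B4GaugeCovariance.b4Green` at `constBond A₀` (`greenA0`) and its covariant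
  derivative (`derivA0`), uniformly in the window, the box, the contour system and `A₀` (from §3 by
  `B4GaugeCovariance.b4Green_constBond` + `scalarOp_box` and §5); `lemma22_17_sup_const` — THE PRINTED STRUCTURE OF
  p. 581 WITH BOTH INPUTS IN KERNEL FORM: constant-`A₀` Lemma 2.2 (proved) + `V` first-order small w.r.t.
  `D^η_{A₀,μ}` (hypothesis) + `(d+2)cε ≤ 1/2` ⇒ `‖GΦ‖_∞ + Σ_μ‖D^η_{A₀,μ}GΦ‖_∞ ≤ 2(d+2)c‖Φ‖_∞` for every
  `G = G_k(□,A₀) + G_k(□,A₀)VG`; `lemma22_16_transfer_const`.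
* §7 THE FIELD `Ã = A₀ + A′`: abbrevs `opA` / `greenA` (`b4Op` / `b4Green` on the fine box at an ARBITRARY bond
  function `A`), `pertV := −vOp …` ([B4]'s perturbation of (2.24)/(2.31) in the lineage's typed form
  `B4Lower18Regular.vOp`, so that `H(□,Ã) = H(□,A₀) − V` by `b4Op_add`), `derivA` (`D^η_{Ã,μ}`);
  `opA_constBond_isUnit_det` (`H(□,A₀)` invertible on the window), `greenA_resolvent` — **(2.31) FOR [B4]'s GREEN'S
  FUNCTION**: `G_k(□,Ã) = G_k(□,A₀) + G_k(□,A₀)VG_k(□,Ã)` given `H(□,Ã)` invertible (`B4Lower18Regular.inv_sub_eq`);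
  `lemma22_17_sup_field` — **(2.17), `q = p = ∞`, `n = 0,1`, FOR `G_k(□,Ã)` ITSELF, ONE HYPOTHESIS AWAY**:
  `IsUnit (H(□,Ã)).det` + `FirstOrderSmall supN V D_{A₀} ε` + `(d+2)cε ≤ 1/2` ⇒
  `‖G_k(□,Ã)Φ‖_∞ + Σ_μ‖D^η_{A₀,μ}G_k(□,Ã)Φ‖_∞ ≤ 2(d+2)c‖Φ‖_∞`; `lemma22_17_sup_field_deriv` — the `D_Ã`-for-`D_{A₀}`
  conversion of p. 581 (`B4Lemma22Reduce231.deriv_convert`): `+ (D_Ã − D_{A₀}) φ-small` ⇒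
  `‖D^η_{Ã,μ}G_k(□,Ã)Φ‖_∞ ≤ (1+φ)2(d+2)c‖Φ‖_∞`.

NOT certified here (separate nodes, recorded in the cell's GAPS/DIVERGENCE files): (a) that [B4]'s concrete
`V_k` of (2.24)–(2.25)/(2.32) (here `pertV`; tree `B4Lower18Regular.vOp`, `b4Op_add`) is first-order small in `‖·‖_∞`
w.r.t. `D_{A₀}` with `ε = O(e^βc₂)` under (1.7) and «Ã is constant in a neighbourhood of ∂□», and the companion bound
on `D_Ã − D_{A₀}` — THE remaining input of (2.31)–(2.33), i.e. exactly the hypotheses `FirstOrderSmall supN (pertV …)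
(derivA0 …) ε` / `hD'` of §7; (a') the invertibility of `H(□,Ã)` is a hypothesis of §7 (for the staircase contours
and (1.7)-regular `Ã` it is the tree's `B4Lower18Regular.green_box_l2_bound`);
(b) at constant `A₀ ≠ 0` only the `‖·‖_∞` clauses `n = 0,1` are instantiated (the `ℓ¹`/dual clauses are given at
`A₀ = 0`, the generic gauge step `l1_hyps_conj` is provided); (c) the Hölder norm (2.16) and the general `(p,q)`
range of (2.17) enter only abstractly through the functional `N` of `lemma22_16_transfer[_const]` (the scalar
(2.16) at `A = 0` is `B4Lemma22ZeroBoxCube.lemma22_16_zero_box`); (d) regions `□` other than boxes (the tree's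
zero-field sup bounds are box theorems, from (2.34)/(2.42) by multiple reflections); (e) of (2.17) only the first
two members at `q = p = ∞` (and, at `A₀ = 0`, `q = p = 1`) — the third member `G_k(□,Ã)D^{η*}_{Ã,μ}` and the rest
of the printed `(p,q)` range are not instantiated.  Constants: printed `c₂` of (2.17) ↦ `2(d+2)c`, `c = max` of the
tree's zero-field constants (`c₁` of (2.16) enters only the abstract transfer).  No step of the manuscript is
used as a hypothesis of a theorem claiming a printed conclusion; 0 cited facts; standard axioms only.

v1.2 (DOCFIX, 2026-08-19; XREAD C-adv4-98 D1 = referee G-ref1-25, C-ref6-143 M1 / C-pv15g10-7, self-audit of every «»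
unit against transcript-B4.md): the header's statement of Lemma 2.2 (formerly a non-printed paraphrase with an
`n = 0,1,2` clause) now quotes (2.16)/(2.17) verbatim and scope (e)/Constants are rephrased accordingly (`c₂`);
in the docstring of `lemma22_17_sup_field_deriv` an unprinted paraphrase formerly set in «» is replaced by the two
verbatim p. 581 sentences plus a sentence labelled as our reading; two clipped quotations completed; no Lean
statement or proof changed.
-/

namespace Literature.MathematicalPhysics.QuantumFieldTheory.Balaban1983to89.B4Lemma22ReduceZero

open Finset Matrix
open scoped Kronecker
open Literature.MathematicalPhysics.QuantumFieldTheory.Balaban1983to89.B4GaugeCovariance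
open Literature.MathematicalPhysics.QuantumFieldTheory.Balaban1983to89.B4Lower18Regular (e1 vOp b4Op_add inv_sub_eq)
open Literature.MathematicalPhysics.QuantumFieldTheory.Balaban1983to89.B4Lemma21Region (siteNorm covDeriv dirKer)
open Literature.MathematicalPhysics.QuantumFieldTheory.Balaban1983to89.B4Lemma22Reduce231
open Literature.MathematicalPhysics.QuantumFieldTheory.Balaban1983to89.B4Reflection242 (boxDom)
open Literature.MathematicalPhysics.QuantumFieldTheory.Balaban1983to89.B4BoxCov237 (boxOpR boxOpR_det_isUnit
  boxOpR_inv_isSymm uvec)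
open Literature.MathematicalPhysics.QuantumFieldTheory.Balaban1983to89.B4Cor23Zero (fdiff fdiffM fdiffM_mulVec
  fdiff_of_mem fdiff_of_not_mem)
open Literature.MathematicalPhysics.QuantumFieldTheory.Balaban1983to89.B4Thm110ZeroBox (lemma22_zero_box_rowSum
  lemma22_zero_box_colSum)
open Literature.MathematicalPhysics.QuantumFieldTheory.Balaban1983to89.B4Thm110ZeroBoxDeriv
  (lemma22_zero_box_deriv_rowSum)
open Literature.MathematicalPhysics.QuantumFieldTheory.Balaban1983to89.B4Lemma22ZeroBoxDerivDual (fwd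
  lemma22_zero_box_deriv_colSum)

noncomputable section

/-! ## §1 The Kronecker lift `S ⊗ 1_ι` of scalar kernels to `N`-component fields («G_k(□,0) = G_k(□)1») -/

section Lift

variable {X Y Z : Type*} {ι : Type} [Fintype X] [Fintype Y] [Fintype Z] [Fintype ι] [DecidableEq ι]

omit [Fintype Y] in
/-- `((S ⊗ 1)Φ)(y) = Σ_x S(y,x) φ(x) ∈ ℝ^ι` — the scalar kernel acts on each colour component.
[cite: Balaban1983RegularityDecay, p. 582 «G_k(□,0) = G_k(□)1, 1 is identity operator on R^N»] -/
theorem fld_kron_mulVec (S : Matrix Y X ℝ) (Φ : X × ι → ℝ) (y : Y) :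
    fld ((S ⊗ₖ (1 : Matrix ι ι ℝ)) *ᵥ Φ) y = ∑ x, S y x • fld Φ x := by
  rw [← blockOp_smul_one, fld_blockOp_mulVec]
  refine sum_congr rfl fun x _ => ?_
  rw [smul_mulVec, one_mulVec]

omit [Fintype X] [Fintype Y] [Fintype Z] [DecidableEq ι] in
/-- the Euclidean site norm is subadditive over finite sums. [folklore] -/
theorem siteNorm_sum_le {α : Type*} (s : Finset α) (v : α → ι → ℝ) :
    siteNorm (∑ a ∈ s, v a) ≤ ∑ a ∈ s, siteNorm (v a) :=
  Finset.le_sum_of_subadditive _ siteNorm_zero.le siteNorm_add_le s v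

omit [Fintype Y] in
/-- `|((S⊗1)Φ)(y)| ≤ Σ_x |S(y,x)| |φ(x)|`. [folklore] -/
theorem siteNorm_kron_row_le (S : Matrix Y X ℝ) (Φ : X × ι → ℝ) (y : Y) :
    siteNorm (fld ((S ⊗ₖ (1 : Matrix ι ι ℝ)) *ᵥ Φ) y) ≤ ∑ x, |S y x| * siteNorm (fld Φ x) := by
  rw [fld_kron_mulVec]
  refine (siteNorm_sum_le _ _).trans (le_of_eq ?_)
  exact sum_congr rfl fun x _ => siteNorm_smul _ _

omit [Fintype Y] in
/-- SCHUR TEST, sup norm: row sums `Σ_x|S(y,x)| ≤ B` give `‖(S ⊗ 1)Φ‖_∞ ≤ B‖Φ‖_∞` for `N`-component fields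
(`‖·‖_∞ = B4Lemma22Reduce231.supN`, the sup of the Euclidean site norms). [folklore] -/
theorem supN_kron_le {S : Matrix Y X ℝ} {B : ℝ} (hB : 0 ≤ B) (h : ∀ y, ∑ x, |S y x| ≤ B) (Φ : X × ι → ℝ) :
    supN ((S ⊗ₖ (1 : Matrix ι ι ℝ)) *ᵥ Φ) ≤ B * supN Φ := by
  refine supN_le (mul_nonneg hB (supN_nonneg Φ)) fun y => (siteNorm_kron_row_le S Φ y).trans ?_
  calc ∑ x, |S y x| * siteNorm (fld Φ x) ≤ ∑ x, |S y x| * supN Φ :=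
        sum_le_sum fun x _ => mul_le_mul_of_nonneg_left (le_supN Φ x) (abs_nonneg _)
    _ = (∑ x, |S y x|) * supN Φ := by rw [sum_mul]
    _ ≤ B * supN Φ := mul_le_mul_of_nonneg_right (h y) (supN_nonneg Φ)

/-- SCHUR TEST, `ℓ¹` norm: column sums `Σ_y|S(y,x)| ≤ B` give `‖(S ⊗ 1)Φ‖₁ ≤ B‖Φ‖₁`
(`‖·‖₁ = B4Lemma22Reduce231.l1N`). [folklore] -/
theorem l1N_kron_le {S : Matrix Y X ℝ} {B : ℝ} (h : ∀ x, ∑ y, |S y x| ≤ B) (Φ : X × ι → ℝ) :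
    l1N ((S ⊗ₖ (1 : Matrix ι ι ℝ)) *ᵥ Φ) ≤ B * l1N Φ := by
  unfold l1N
  calc ∑ y, siteNorm (fld ((S ⊗ₖ (1 : Matrix ι ι ℝ)) *ᵥ Φ) y)
        ≤ ∑ y, ∑ x, |S y x| * siteNorm (fld Φ x) := sum_le_sum fun y _ => siteNorm_kron_row_le S Φ y
    _ = ∑ x, (∑ y, |S y x|) * siteNorm (fld Φ x) := by
        rw [sum_comm]
        exact sum_congr rfl fun x _ => (sum_mul _ _ _).symm
    _ ≤ ∑ x, B * siteNorm (fld Φ x) :=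
        sum_le_sum fun x _ => mul_le_mul_of_nonneg_right (h x) (siteNorm_nonneg _)
    _ = B * ∑ x, siteNorm (fld Φ x) := by rw [mul_sum]

omit [Fintype Z] in
/-- `(T ⊗ 1)((S ⊗ 1)Φ) = ((TS) ⊗ 1)Φ` — composition of lifted scalar operators. [folklore] -/
theorem kron_mulVec_kron_mulVec (T : Matrix Z Y ℝ) (S : Matrix Y X ℝ) (Φ : X × ι → ℝ) :
    (T ⊗ₖ (1 : Matrix ι ι ℝ)) *ᵥ ((S ⊗ₖ (1 : Matrix ι ι ℝ)) *ᵥ Φ)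
      = ((T * S) ⊗ₖ (1 : Matrix ι ι ℝ)) *ᵥ Φ := by
  rw [mulVec_mulVec, ← mul_kronecker_mul, Matrix.mul_one]

/-- an invertible scalar operator lifts to an invertible `N`-component operator. [folklore] -/
theorem kron_one_isUnit_det [DecidableEq X] {S : Matrix X X ℝ} (hS : IsUnit S.det) :
    IsUnit (S ⊗ₖ (1 : Matrix ι ι ℝ)).det := by
  refine Matrix.isUnit_det_of_right_inverse (B := S⁻¹ ⊗ₖ (1 : Matrix ι ι ℝ)) ?_
  rw [← mul_kronecker_mul, mul_nonsing_inv S hS, Matrix.mul_one, one_kronecker_one]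

omit [Fintype X] [Fintype Y] [Fintype Z] [Fintype ι] in
/-- the transpose of a lifted scalar operator is the lift of the transpose. [folklore] -/
theorem kron_one_transpose (S : Matrix Y X ℝ) :
    (S ⊗ₖ (1 : Matrix ι ι ℝ))ᵀ = Sᵀ ⊗ₖ (1 : Matrix ι ι ℝ) := by
  ext ⟨x, i⟩ ⟨y, j⟩
  simp [Matrix.kroneckerMap_apply, Matrix.one_apply, eq_comm]

end Lift

/-! ## §2 The scalar kernel of `D^η_μ ∘ G` on a region (Neumann convention (1.3)) -/

section Scalar

variable {d : ℕ}

/-- `(D^η_μG)(x,x') = (D^η_μ G(·,x'))(x)`: the matrix product `fdiffM * G` differentiates the columns of `G`.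
[cite: Balaban1983RegularityDecay, (1.3) p. 572] -/
theorem fdiffM_mul_apply {n : ℕ} {R : Finset (Fin (d + 1) → ℤ)} (μ : Fin (d + 1)) (G : Matrix ↥R ↥R ℝ)
    (x x' : ↥R) : (fdiffM n R μ * G) x x' = fdiff n R μ (fun y => G y x') x := by
  rw [← fdiffM_mulVec]
  rfl

/-- on a bond `⟨x, x + ηe_μ⟩ ⊂ R`: `(D^η_μG)(x,x') = η^{-1}(G(x+ηe_μ,x') − G(x,x'))`.
[cite: Balaban1983RegularityDecay, (1.3) p. 572] -/
theorem fdiffM_mul_apply_of_mem {n : ℕ} {R : Finset (Fin (d + 1) → ℤ)} {μ : Fin (d + 1)}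
    (G : Matrix ↥R ↥R ℝ) {x : ↥R} (hx : x.1 + Pi.single μ 1 ∈ R) (x' : ↥R) :
    (fdiffM n R μ * G) x x' = (n : ℝ) * (G ⟨x.1 + Pi.single μ 1, hx⟩ x' - G x x') := by
  rw [fdiffM_mul_apply, fdiff_of_mem _ (show x.1 + uvec μ ∈ R from hx)]
  rfl

/-- no bond, no difference: if `x + ηe_μ ∉ R` the row of `D^η_μG` at `x` vanishes (Neumann boundary condition).
[cite: Balaban1983RegularityDecay, (1.3) p. 572] -/
theorem fdiffM_mul_apply_of_not_mem {n : ℕ} {R : Finset (Fin (d + 1) → ℤ)} {μ : Fin (d + 1)}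
    (G : Matrix ↥R ↥R ℝ) {x : ↥R} (hx : x.1 + Pi.single μ 1 ∉ R) (x' : ↥R) :
    (fdiffM n R μ * G) x x' = 0 := by
  rw [fdiffM_mul_apply, fdiff_of_not_mem _ (show x.1 + uvec μ ∉ R from hx)]

/-- on a box, with the tree's forward-neighbour map `fwd` (`= x + e_μ` if in the box, else `x`):
`(D^η_μG)(x,x') = η^{-1}(G(fwd x, x') − G(x,x'))` in all cases. [folklore] -/
theorem fdiffM_mul_apply_fwd {N : Fin (d + 1) → ℕ} {n : ℕ} (μ : Fin (d + 1))
    (G : Matrix ↥(boxDom N) ↥(boxDom N) ℝ) (x x' : ↥(boxDom N)) :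
    (fdiffM n (boxDom N) μ * G) x x' = (n : ℝ) * (G (fwd N μ x) x' - G x x') := by
  by_cases hx : x.1 + Pi.single μ 1 ∈ boxDom N
  · have hf : fwd N μ x = ⟨x.1 + Pi.single μ 1, hx⟩ := by
      unfold fwd
      rw [dif_pos hx]
    rw [fdiffM_mul_apply_of_mem G hx, hf]
  · have hf : fwd N μ x = x := by
      unfold fwd
      rw [dif_neg hx]
    rw [fdiffM_mul_apply_of_not_mem G hx, hf, sub_self, mul_zero]

/-- row sums of `D^η_μG` from the bondwise row-sum bound (the shape of the tree's
`B4Thm110ZeroBoxDeriv.lemma22_zero_box_deriv_rowSum`). [folklore] -/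
theorem rowSum_fdiffM_mul_le {n : ℕ} {R : Finset (Fin (d + 1) → ℤ)} {μ : Fin (d + 1)}
    (G : Matrix ↥R ↥R ℝ) {c₀ : ℝ} (hc₀ : 0 ≤ c₀)
    (h : ∀ x xe : ↥R, xe.1 = x.1 + Pi.single μ 1 → ∑ x', |(n : ℝ) * (G xe x' - G x x')| ≤ c₀) (x : ↥R) :
    ∑ x', |(fdiffM n R μ * G) x x'| ≤ c₀ := by
  by_cases hx : x.1 + Pi.single μ 1 ∈ R
  · simp_rw [fdiffM_mul_apply_of_mem G hx]
    exact h x ⟨x.1 + Pi.single μ 1, hx⟩ rfl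
  · simp [fdiffM_mul_apply_of_not_mem G hx, hc₀]

end Scalar

/-! ## §3 The zero-field hypotheses of the bootstrap: (2.17) at `A = 0`, `p = q ∈ {∞, 1}`, `n = 0,1`, vector form -/

section ZeroField

variable (d : ℕ)

/-- the box `□ = {x ∈ ℤ^{d+1} : 0 ≤ x_μ < L^kM_μ}` in `η = L^{-k}`-lattice units, `L = ℓ + 1` (the carrier of the
tree's zero-field box theorems).
[cite: Balaban1983RegularityDecay, p. 584 «□ = {x ∈ ξZ^d : 0 ≤ x_μ ≤ M_μ, μ = 1,…,d}»] -/
abbrev Box (ℓ k : ℕ) (M : Fin (d + 1) → ℕ) : Finset (Fin (d + 1) → ℤ) :=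
  boxDom (fun i => (ℓ + 1) ^ k * M i)

/-- the one-component zero-field propagator `G_k(□) = (−Δ^{η,N}_□ + m² + a_kP_k)^{-1}` of the tree
(`B4BoxCov237.boxOpR` with the running coefficient `a_k = B1.aSeq a L k`).
[cite: Balaban1983RegularityDecay, (1.6) p. 572; p. 582 «the one-component propagator G_k(□)»] -/
abbrev gk (ℓ k : ℕ) (a m2 : ℝ) (M : Fin (d + 1) → ℕ) : Matrix ↥(Box d ℓ k M) ↥(Box d ℓ k M) ℝ :=
  (boxOpR ((ℓ + 1) ^ k) (B1.aSeq a ((ℓ : ℝ) + 1) k) m2 M)⁻¹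

/-- the scalar zero-field derivative `D^η_{0,μ}` on the box (`B4Cor23Zero.fdiffM`, mesh `η = L^{-k}`).
[cite: Balaban1983RegularityDecay, (1.3) p. 572] -/
abbrev dk (ℓ k : ℕ) (M : Fin (d + 1) → ℕ) (μ : Fin (d + 1)) : Matrix ↥(Box d ℓ k M) ↥(Box d ℓ k M) ℝ :=
  fdiffM ((ℓ + 1) ^ k) (Box d ℓ k M) μ

variable {d}

/-- **THE `A₀ = 0` SUP-NORM HYPOTHESES** of `B4Lemma22Reduce231.reduce_sup`, from the tree's zero-field box
theorems: uniformly over the window, `‖(G_k(□)⊗1)Φ‖_∞ ≤ c‖Φ‖_∞` and `‖(D^η_μ⊗1)(G_k(□)⊗1)Φ‖_∞ ≤ c‖Φ‖_∞` for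
every `N`-component field `Φ` — (2.17) at `A = 0`, `q = p = ∞`, `n = 0,1`, in the form «G_k(□,0) = G_k(□)1».
[cite: Balaban1983RegularityDecay, Lemma 2.2 (2.17) p. 578; p. 582] -/
theorem zero_box_sup (ι : Type) [Fintype ι] [DecidableEq ι] (d ℓ : ℕ) (hℓ : 1 ≤ ℓ)
    (amin aplus m2plus : ℝ) (ha : 0 < amin) :
    ∃ c : ℝ, 0 < c ∧ ∀ (k : ℕ), 1 ≤ k → ∀ (a m2 : ℝ), amin ≤ a → a ≤ aplus → 0 ≤ m2 → m2 ≤ m2plus →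
      ∀ (M : Fin (d + 1) → ℕ), (∀ i, 1 ≤ M i) →
        (∀ Φ : ↥(Box d ℓ k M) × ι → ℝ,
            supN ((gk d ℓ k a m2 M ⊗ₖ (1 : Matrix ι ι ℝ)) *ᵥ Φ) ≤ c * supN Φ) ∧
        (∀ (μ : Fin (d + 1)) (Φ : ↥(Box d ℓ k M) × ι → ℝ),
            supN ((dk d ℓ k M μ ⊗ₖ (1 : Matrix ι ι ℝ)) *ᵥ ((gk d ℓ k a m2 M ⊗ₖ (1 : Matrix ι ι ℝ)) *ᵥ Φ))
              ≤ c * supN Φ) := by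
  obtain ⟨c₁, hc₁, h₁⟩ := lemma22_zero_box_rowSum d ℓ hℓ amin aplus m2plus ha
  obtain ⟨c₂, hc₂, h₂⟩ := lemma22_zero_box_deriv_rowSum d ℓ hℓ amin aplus m2plus ha
  refine ⟨max c₁ c₂, lt_max_of_lt_left hc₁, ?_⟩
  intro k hk a m2 e1 e2 e3 e4 M hM
  refine ⟨fun Φ => ?_, fun μ Φ => ?_⟩
  · exact supN_kron_le (le_max_of_le_left hc₁.le)
      (fun y => (h₁ k hk a m2 e1 e2 e3 e4 M hM y).trans (le_max_left _ _)) Φ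
  · rw [kron_mulVec_kron_mulVec]
    exact supN_kron_le (le_max_of_le_right hc₂.le)
      (fun y => (rowSum_fdiffM_mul_le _ hc₂.le
        (fun x xe hxe => h₂ k hk a m2 e1 e2 e3 e4 M hM μ x xe hxe) y).trans (le_max_right _ _)) Φ

/-- **THE `A₀ = 0` `ℓ¹`-NORM HYPOTHESES** of `B4Lemma22Reduce231.reduce_l1` / `bootstrap_dual`: uniformly over the
window, `‖(G_k(□)⊗1)Φ‖₁ ≤ c‖Φ‖₁` and `‖(D^η_μ⊗1)(G_k(□)⊗1)Φ‖₁ ≤ c‖Φ‖₁` — (2.17) at `A = 0`, `q = p = 1`,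
`n = 0,1` (column sums; p. 583 «For q = p = 1 we get it by duality argument»).
[cite: Balaban1983RegularityDecay, Lemma 2.2 (2.17) p. 578; p. 583] -/
theorem zero_box_l1 (ι : Type) [Fintype ι] [DecidableEq ι] (d ℓ : ℕ) (hℓ : 1 ≤ ℓ)
    (amin aplus m2plus : ℝ) (ha : 0 < amin) :
    ∃ c : ℝ, 0 < c ∧ ∀ (k : ℕ), 1 ≤ k → ∀ (a m2 : ℝ), amin ≤ a → a ≤ aplus → 0 ≤ m2 → m2 ≤ m2plus →
      ∀ (M : Fin (d + 1) → ℕ), (∀ i, 1 ≤ M i) →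
        (∀ Φ : ↥(Box d ℓ k M) × ι → ℝ,
            l1N ((gk d ℓ k a m2 M ⊗ₖ (1 : Matrix ι ι ℝ)) *ᵥ Φ) ≤ c * l1N Φ) ∧
        (∀ (μ : Fin (d + 1)) (Φ : ↥(Box d ℓ k M) × ι → ℝ),
            l1N ((dk d ℓ k M μ ⊗ₖ (1 : Matrix ι ι ℝ)) *ᵥ ((gk d ℓ k a m2 M ⊗ₖ (1 : Matrix ι ι ℝ)) *ᵥ Φ))
              ≤ c * l1N Φ) := by
  obtain ⟨c₁, hc₁, h₁⟩ := lemma22_zero_box_colSum d ℓ hℓ amin aplus m2plus ha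
  obtain ⟨c₂, hc₂, h₂⟩ := lemma22_zero_box_deriv_colSum d ℓ hℓ amin aplus m2plus ha
  refine ⟨max c₁ c₂, lt_max_of_lt_left hc₁, ?_⟩
  intro k hk a m2 e1 e2 e3 e4 M hM
  refine ⟨fun Φ => ?_, fun μ Φ => ?_⟩
  · exact l1N_kron_le (fun x' => (h₁ k hk a m2 e1 e2 e3 e4 M hM x').trans (le_max_left _ _)) Φ
  · rw [kron_mulVec_kron_mulVec]
    refine l1N_kron_le (fun x' => ?_) Φ
    calc ∑ x, |(dk d ℓ k M μ * gk d ℓ k a m2 M) x x'|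
          = ∑ x, |((((ℓ + 1) ^ k : ℕ) : ℝ)) * (gk d ℓ k a m2 M (fwd _ μ x) x' - gk d ℓ k a m2 M x x')| :=
            sum_congr rfl fun x _ => by rw [fdiffM_mul_apply_fwd]
      _ ≤ c₂ := h₂ k hk a m2 e1 e2 e3 e4 M hM μ x'
      _ ≤ max c₁ c₂ := le_max_right _ _

end ZeroField

/-! ## §4 Headlines: Lemma 2.2 (2.17)_∞ for every first-order-small perturbation of `G_k(□,0) ⊗ 1` -/

section Headline

variable {d : ℕ}

/-- `m + 1 = d + 2` for the `d + 1` lattice directions. [folklore] -/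
theorem card_dir_add_one (d : ℕ) : ((Fintype.card (Fin (d + 1)) : ℝ) + 1) = (d : ℝ) + 2 := by
  rw [Fintype.card_fin]
  push_cast
  ring

/-- **LEMMA 2.2 (2.17), `q = p = ∞`, `n = 0,1`, FOR THE PERTURBED PROPAGATOR — the (2.31)–(2.33) inference with
its `A₀ = 0` hypotheses discharged by kernel theorems.**  For every level `k ≥ 1`, coefficients in the window, every
box `□`, every number of colours `N = |ι|`: if `V` is «a first order differential operator with small coefficients»
in `‖·‖_∞` w.r.t. the zero-field derivatives (`‖Vu‖_∞ ≤ ε(‖u‖_∞ + Σ_μ‖(D^η_μ⊗1)u‖_∞)`) with `(d+2)cε ≤ 1/2`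
(«for e sufficiently small»), then every `G` with `G = G_k(□,0)⊗1 + (G_k(□,0)⊗1)VG` ((2.26)/(2.31)) satisfies
`‖GΦ‖_∞ + Σ_μ‖(D^η_μ⊗1)GΦ‖_∞ ≤ 2(d+2)c‖Φ‖_∞`.
[cite: Balaban1983RegularityDecay, Lemma 2.2 (2.17) p. 578; proof p. 581 (2.31)–(2.33), p. 582] -/
theorem lemma22_17_sup (ι : Type) [Fintype ι] [DecidableEq ι] (d ℓ : ℕ) (hℓ : 1 ≤ ℓ)
    (amin aplus m2plus : ℝ) (ha : 0 < amin) :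
    ∃ c : ℝ, 0 < c ∧ ∀ (k : ℕ), 1 ≤ k → ∀ (a m2 : ℝ), amin ≤ a → a ≤ aplus → 0 ≤ m2 → m2 ≤ m2plus →
      ∀ (M : Fin (d + 1) → ℕ), (∀ i, 1 ≤ M i) →
      ∀ (V G : Matrix (↥(Box d ℓ k M) × ι) (↥(Box d ℓ k M) × ι) ℝ) (ε : ℝ),
        G = gk d ℓ k a m2 M ⊗ₖ (1 : Matrix ι ι ℝ) + gk d ℓ k a m2 M ⊗ₖ (1 : Matrix ι ι ℝ) * V * G →
        FirstOrderSmall supN V (fun μ => dk d ℓ k M μ ⊗ₖ (1 : Matrix ι ι ℝ)) ε →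
        ((d : ℝ) + 2) * c * ε ≤ 1 / 2 →
        ∀ Φ : ↥(Box d ℓ k M) × ι → ℝ,
          supN (G *ᵥ Φ) + ∑ μ, supN ((dk d ℓ k M μ ⊗ₖ (1 : Matrix ι ι ℝ)) *ᵥ (G *ᵥ Φ))
            ≤ 2 * (((d : ℝ) + 2) * c) * supN Φ := by
  obtain ⟨c, hc, h⟩ := zero_box_sup ι d ℓ hℓ amin aplus m2plus ha
  refine ⟨c, hc, ?_⟩
  intro k hk a m2 e1 e2 e3 e4 M hM V G ε hres hV hsm Φ
  obtain ⟨h0, hD⟩ := h k hk a m2 e1 e2 e3 e4 M hM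
  have key := reduce_sup (κ := Fin (d + 1)) hres hc.le h0 hD hV (by rw [card_dir_add_one]; exact hsm) Φ
  rw [card_dir_add_one] at key
  exact key

/-- the same for `G = (H_k(□)⊗1 − V)^{-1}`, `H_k(□) = −Δ^{η,N}_□ + m² + a_kP_k` the tree's box operator
(`B4BoxCov237.boxOpR`, invertible by `boxOpR_det_isUnit`), the invertibility of the perturbed operator being a
hypothesis. [cite: Balaban1983RegularityDecay, Lemma 2.2 (2.17) p. 578; (2.26) p. 580; (2.31)–(2.33) p. 581] -/
theorem lemma22_17_sup_inv (ι : Type) [Fintype ι] [DecidableEq ι] (d ℓ : ℕ) (hℓ : 1 ≤ ℓ)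
    (amin aplus m2plus : ℝ) (ha : 0 < amin) :
    ∃ c : ℝ, 0 < c ∧ ∀ (k : ℕ), 1 ≤ k → ∀ (a m2 : ℝ), amin ≤ a → a ≤ aplus → 0 ≤ m2 → m2 ≤ m2plus →
      ∀ (M : Fin (d + 1) → ℕ), (∀ i, 1 ≤ M i) →
      ∀ (V : Matrix (↥(Box d ℓ k M) × ι) (↥(Box d ℓ k M) × ι) ℝ) (ε : ℝ),
        IsUnit (boxOpR ((ℓ + 1) ^ k) (B1.aSeq a ((ℓ : ℝ) + 1) k) m2 M ⊗ₖ (1 : Matrix ι ι ℝ) - V).det →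
        FirstOrderSmall supN V (fun μ => dk d ℓ k M μ ⊗ₖ (1 : Matrix ι ι ℝ)) ε →
        ((d : ℝ) + 2) * c * ε ≤ 1 / 2 →
        ∀ Φ : ↥(Box d ℓ k M) × ι → ℝ,
          supN ((boxOpR ((ℓ + 1) ^ k) (B1.aSeq a ((ℓ : ℝ) + 1) k) m2 M ⊗ₖ (1 : Matrix ι ι ℝ) - V)⁻¹ *ᵥ Φ)
            + ∑ μ, supN ((dk d ℓ k M μ ⊗ₖ (1 : Matrix ι ι ℝ)) *ᵥ
                ((boxOpR ((ℓ + 1) ^ k) (B1.aSeq a ((ℓ : ℝ) + 1) k) m2 M ⊗ₖ (1 : Matrix ι ι ℝ) - V)⁻¹ *ᵥ Φ))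
            ≤ 2 * (((d : ℝ) + 2) * c) * supN Φ := by
  obtain ⟨c, hc, h⟩ := zero_box_sup ι d ℓ hℓ amin aplus m2plus ha
  refine ⟨c, hc, ?_⟩
  intro k hk a m2 e1 e2 e3 e4 M hM V ε hH hV hsm Φ
  obtain ⟨h0, hD⟩ := h k hk a m2 e1 e2 e3 e4 M hM
  have hL : (1 : ℝ) < (ℓ : ℝ) + 1 := by
    have : (1 : ℝ) ≤ (ℓ : ℝ) := by exact_mod_cast hℓ
    linarith
  have hak : 0 < B1.aSeq a ((ℓ : ℝ) + 1) k := B1.aSeq_pos (lt_of_lt_of_le ha e1) hL hk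
  have hn : 1 ≤ (ℓ + 1) ^ k := Nat.one_le_pow _ _ (Nat.succ_pos ℓ)
  have hS : IsUnit (boxOpR ((ℓ + 1) ^ k) (B1.aSeq a ((ℓ : ℝ) + 1) k) m2 M).det :=
    boxOpR_det_isUnit hn hak e3 hM
  have hH₀ := kron_one_isUnit_det (ι := ι) hS
  have hinv : (boxOpR ((ℓ + 1) ^ k) (B1.aSeq a ((ℓ : ℝ) + 1) k) m2 M ⊗ₖ (1 : Matrix ι ι ℝ))⁻¹
      = gk d ℓ k a m2 M ⊗ₖ (1 : Matrix ι ι ℝ) := inv_kronecker_one hS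
  have key := reduce_sup_inv (κ := Fin (d + 1)) hH₀ hH hc.le (by rw [hinv]; exact h0) (by rw [hinv]; exact hD)
    hV (by rw [card_dir_add_one]; exact hsm) Φ
  rw [card_dir_add_one] at key
  exact key

/-- **the `ℓ¹` instance** ((2.17) at `q = p = 1`, `n = 0,1`, for the perturbed propagator, first-order smallness
measured in `‖·‖₁`). [cite: Balaban1983RegularityDecay, Lemma 2.2 (2.17) p. 578; p. 581 (2.31)–(2.33); p. 583] -/
theorem lemma22_17_l1 (ι : Type) [Fintype ι] [DecidableEq ι] (d ℓ : ℕ) (hℓ : 1 ≤ ℓ)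
    (amin aplus m2plus : ℝ) (ha : 0 < amin) :
    ∃ c : ℝ, 0 < c ∧ ∀ (k : ℕ), 1 ≤ k → ∀ (a m2 : ℝ), amin ≤ a → a ≤ aplus → 0 ≤ m2 → m2 ≤ m2plus →
      ∀ (M : Fin (d + 1) → ℕ), (∀ i, 1 ≤ M i) →
      ∀ (V G : Matrix (↥(Box d ℓ k M) × ι) (↥(Box d ℓ k M) × ι) ℝ) (ε : ℝ),
        G = gk d ℓ k a m2 M ⊗ₖ (1 : Matrix ι ι ℝ) + gk d ℓ k a m2 M ⊗ₖ (1 : Matrix ι ι ℝ) * V * G →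
        FirstOrderSmall l1N V (fun μ => dk d ℓ k M μ ⊗ₖ (1 : Matrix ι ι ℝ)) ε →
        ((d : ℝ) + 2) * c * ε ≤ 1 / 2 →
        ∀ Φ : ↥(Box d ℓ k M) × ι → ℝ,
          l1N (G *ᵥ Φ) + ∑ μ, l1N ((dk d ℓ k M μ ⊗ₖ (1 : Matrix ι ι ℝ)) *ᵥ (G *ᵥ Φ))
            ≤ 2 * (((d : ℝ) + 2) * c) * l1N Φ := by
  obtain ⟨c, hc, h⟩ := zero_box_l1 ι d ℓ hℓ amin aplus m2plus ha
  refine ⟨c, hc, ?_⟩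
  intro k hk a m2 e1 e2 e3 e4 M hM V G ε hres hV hsm Φ
  obtain ⟨h0, hD⟩ := h k hk a m2 e1 e2 e3 e4 M hM
  have key := reduce_l1 (κ := Fin (d + 1)) hres hc.le h0 hD hV (by rw [card_dir_add_one]; exact hsm) Φ
  rw [card_dir_add_one] at key
  exact key

/-- **the clause `G_k(□,Ã)D^{η*}_μ` of (2.17) at `q = ∞`** («The inequality (2.17) is proved in the same way») for
a symmetric perturbed propagator: `‖G(D^η_μ⊗1)^⊤f‖_∞ ≤ 2(d+2)c‖f‖_∞`, from the `ℓ¹` instance by duality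
(`B4Lemma22Reduce231.bootstrap_dual`). [cite: Balaban1983RegularityDecay, Lemma 2.2 (2.17) p. 578; p. 581; p. 583
«by duality argument»] -/
theorem lemma22_17_dual (ι : Type) [Fintype ι] [DecidableEq ι] (d ℓ : ℕ) (hℓ : 1 ≤ ℓ)
    (amin aplus m2plus : ℝ) (ha : 0 < amin) :
    ∃ c : ℝ, 0 < c ∧ ∀ (k : ℕ), 1 ≤ k → ∀ (a m2 : ℝ), amin ≤ a → a ≤ aplus → 0 ≤ m2 → m2 ≤ m2plus →
      ∀ (M : Fin (d + 1) → ℕ), (∀ i, 1 ≤ M i) →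
      ∀ (V G : Matrix (↥(Box d ℓ k M) × ι) (↥(Box d ℓ k M) × ι) ℝ) (ε : ℝ),
        G = gk d ℓ k a m2 M ⊗ₖ (1 : Matrix ι ι ℝ) + gk d ℓ k a m2 M ⊗ₖ (1 : Matrix ι ι ℝ) * V * G →
        Gᵀ = G →
        FirstOrderSmall l1N V (fun μ => dk d ℓ k M μ ⊗ₖ (1 : Matrix ι ι ℝ)) ε →
        ((d : ℝ) + 2) * c * ε ≤ 1 / 2 →
        ∀ (μ : Fin (d + 1)) (f : ↥(Box d ℓ k M) × ι → ℝ),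
          supN ((G * (dk d ℓ k M μ ⊗ₖ (1 : Matrix ι ι ℝ))ᵀ) *ᵥ f) ≤ 2 * (((d : ℝ) + 2) * c) * supN f := by
  obtain ⟨c, hc, h⟩ := zero_box_l1 ι d ℓ hℓ amin aplus m2plus ha
  refine ⟨c, hc, ?_⟩
  intro k hk a m2 e1 e2 e3 e4 M hM V G ε hres hGt hV hsm μ f
  obtain ⟨h0, hD⟩ := h k hk a m2 e1 e2 e3 e4 M hM
  have key := bootstrap_dual (κ := Fin (d + 1)) (D := fun μ => dk d ℓ k M μ ⊗ₖ (1 : Matrix ι ι ℝ))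
    hres hGt hc.le h0 hD hV (by rw [card_dir_add_one]; exact hsm) μ f
  rw [card_dir_add_one] at key
  exact key

/-- **(2.33) / the (2.16)-shape TRANSFER with the `A₀ = 0` sup hypotheses discharged**: any subadditive functional
`N` (e.g. a Hölder-type norm `‖·‖_{1,α}`) with `N((G_k(□,0)⊗1)Φ) ≤ c₁‖Φ‖_∞` satisfies `N(GΦ) ≤ 2c₁‖Φ‖_∞` for
the perturbed propagator («‖G_k(□,Ã)f‖_{1,α} ≤ O(1)c₁ Σ … ‖f‖_∞»).
[cite: Balaban1983RegularityDecay, (2.33) p. 581; Lemma 2.2 (2.16) p. 578] -/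
theorem lemma22_16_transfer (ι : Type) [Fintype ι] [DecidableEq ι] (d ℓ : ℕ) (hℓ : 1 ≤ ℓ)
    (amin aplus m2plus : ℝ) (ha : 0 < amin) :
    ∃ c : ℝ, 0 < c ∧ ∀ (k : ℕ), 1 ≤ k → ∀ (a m2 : ℝ), amin ≤ a → a ≤ aplus → 0 ≤ m2 → m2 ≤ m2plus →
      ∀ (M : Fin (d + 1) → ℕ), (∀ i, 1 ≤ M i) →
      ∀ (V G : Matrix (↥(Box d ℓ k M) × ι) (↥(Box d ℓ k M) × ι) ℝ) (ε : ℝ),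
        G = gk d ℓ k a m2 M ⊗ₖ (1 : Matrix ι ι ℝ) + gk d ℓ k a m2 M ⊗ₖ (1 : Matrix ι ι ℝ) * V * G →
        FirstOrderSmall supN V (fun μ => dk d ℓ k M μ ⊗ₖ (1 : Matrix ι ι ℝ)) ε → 0 ≤ ε →
        ((d : ℝ) + 2) * c * ε ≤ 1 / 2 →
        ∀ (N : (↥(Box d ℓ k M) × ι → ℝ) → ℝ), (∀ Φ Ψ, N (Φ + Ψ) ≤ N Φ + N Ψ) →
        ∀ (c₁ : ℝ), 0 ≤ c₁ → (∀ Φ, N ((gk d ℓ k a m2 M ⊗ₖ (1 : Matrix ι ι ℝ)) *ᵥ Φ) ≤ c₁ * supN Φ) →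
        ∀ Φ : ↥(Box d ℓ k M) × ι → ℝ, N (G *ᵥ Φ) ≤ 2 * c₁ * supN Φ := by
  obtain ⟨c, hc, h⟩ := zero_box_sup ι d ℓ hℓ amin aplus m2plus ha
  refine ⟨c, hc, ?_⟩
  intro k hk a m2 e1 e2 e3 e4 M hM V G ε hres hV hε hsm N hNadd c₁ hc₁ hN0 Φ
  obtain ⟨h0, hD⟩ := h k hk a m2 e1 e2 e3 e4 M hM
  exact transfer (κ := Fin (d + 1)) supN_nonneg supN_add_le hres hc.le hε h0 hD hV
    (by rw [card_dir_add_one]; exact hsm) hNadd hc₁ hN0 Φ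

/-- the zero perturbation is first-order small with `ε = 0` (in any of the mixed norms vanishing at `0`). [folklore] -/
theorem firstOrderSmall_zero {X : Type*} {ι : Type} [Fintype X] [Fintype ι] {κ : Type*} [Fintype κ]
    {ν : (X × ι → ℝ) → ℝ} (hν : ν 0 = 0) (D : κ → Matrix (X × ι) (X × ι) ℝ) :
    FirstOrderSmall ν (0 : Matrix (X × ι) (X × ι) ℝ) D 0 := by
  intro u
  rw [zero_mulVec, hν, zero_mul]

/-- **NON-VACUITY / THE VECTOR FORM OF THE TREE'S ZERO-FIELD THEOREMS**: at `V = 0` the headline returns (2.17)_∞,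
`n = 0,1`, for the `N`-component zero-field propagator `G_k(□,0) = G_k(□)⊗1` itself:
`‖(G_k(□)⊗1)Φ‖_∞ + Σ_μ‖(D^η_μ⊗1)(G_k(□)⊗1)Φ‖_∞ ≤ 2(d+2)c‖Φ‖_∞` — every hypothesis of `lemma22_17_sup` is met.
[cite: Balaban1983RegularityDecay, Lemma 2.2 (2.17) p. 578; p. 582 «G_k(□,0) = G_k(□)1»] -/
theorem lemma22_17_sup_zeroField (ι : Type) [Fintype ι] [DecidableEq ι] (d ℓ : ℕ) (hℓ : 1 ≤ ℓ)
    (amin aplus m2plus : ℝ) (ha : 0 < amin) :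
    ∃ c : ℝ, 0 < c ∧ ∀ (k : ℕ), 1 ≤ k → ∀ (a m2 : ℝ), amin ≤ a → a ≤ aplus → 0 ≤ m2 → m2 ≤ m2plus →
      ∀ (M : Fin (d + 1) → ℕ), (∀ i, 1 ≤ M i) →
        ∀ Φ : ↥(Box d ℓ k M) × ι → ℝ,
          supN ((gk d ℓ k a m2 M ⊗ₖ (1 : Matrix ι ι ℝ)) *ᵥ Φ)
            + ∑ μ, supN ((dk d ℓ k M μ ⊗ₖ (1 : Matrix ι ι ℝ)) *ᵥ ((gk d ℓ k a m2 M ⊗ₖ (1 : Matrix ι ι ℝ)) *ᵥ Φ))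
            ≤ 2 * (((d : ℝ) + 2) * c) * supN Φ := by
  obtain ⟨c, hc, h⟩ := lemma22_17_sup ι d ℓ hℓ amin aplus m2plus ha
  refine ⟨c, hc, ?_⟩
  intro k hk a m2 e1 e2 e3 e4 M hM Φ
  have hsm : ((d : ℝ) + 2) * c * 0 ≤ 1 / 2 := by norm_num
  exact h k hk a m2 e1 e2 e3 e4 M hM 0 _ 0 (by rw [Matrix.mul_zero, Matrix.zero_mul, add_zero])
    (firstOrderSmall_zero supN_zero _) hsm Φ

end Headline

/-! ## §5 «the same argument with the gauge transformation»: the mixed norms are gauge invariant, and the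
bootstrap hypotheses pass from `(G₀, D_μ)` to the conjugates `(𝒢G₀𝒢ᵀ, 𝒢D_μ𝒢ᵀ)` -/

section Gauge

variable {X : Type*} {ι : Type} [Fintype X] [Fintype ι] [DecidableEq X] [DecidableEq ι]

omit [Fintype X] [DecidableEq X] in
/-- an orthogonal matrix preserves the Euclidean site norm: `|g(x)v| = |v|`. [folklore] -/
theorem siteNorm_gauge_mulVec {g : X → Matrix ι ι ℝ} (hg : IsGauge g) (x : X) (v : ι → ℝ) :
    siteNorm (g x *ᵥ v) = siteNorm v := by
  unfold siteNorm
  rw [hg.dotProduct_mulVec_self]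

/-- **`‖𝒢Φ‖_∞ = ‖Φ‖_∞`** — the sup norm of Lemma 2.2 is invariant under gauge transformations
`(𝒢Φ)(x) = g(x)φ(x)`, `g(x)` orthogonal. [cite: Balaban1983RegularityDecay, p. 581 «by the same argument with the
gauge transformation»] -/
theorem supN_gauge {g : X → Matrix ι ι ℝ} (hg : IsGauge g) (Φ : X × ι → ℝ) :
    supN (blockDiag g *ᵥ Φ) = supN Φ := by
  unfold supN
  exact iSup_congr fun x => by rw [fld_blockDiag_mulVec, siteNorm_gauge_mulVec hg]

/-- **`‖𝒢Φ‖₁ = ‖Φ‖₁`**. [folklore] -/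
theorem l1N_gauge {g : X → Matrix ι ι ℝ} (hg : IsGauge g) (Φ : X × ι → ℝ) :
    l1N (blockDiag g *ᵥ Φ) = l1N Φ := by
  unfold l1N
  exact sum_congr rfl fun x _ => by rw [fld_blockDiag_mulVec, siteNorm_gauge_mulVec hg]

omit [Fintype X] [DecidableEq X] in
/-- the inverse gauge transformation `x ↦ g(x)ᵀ` is a gauge transformation. [folklore] -/
theorem isGauge_transpose {g : X → Matrix ι ι ℝ} (hg : IsGauge g) : IsGauge fun x => (g x)ᵀ := by
  intro x
  rw [transpose_transpose]
  exact hg.mul_transpose x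

/-- `‖𝒢ᵀΦ‖_∞ = ‖Φ‖_∞`. [folklore] -/
theorem supN_gauge_transpose {g : X → Matrix ι ι ℝ} (hg : IsGauge g) (Φ : X × ι → ℝ) :
    supN ((blockDiag g)ᵀ *ᵥ Φ) = supN Φ := by
  rw [B4GaugeCovariance.blockDiag_transpose]
  exact supN_gauge (isGauge_transpose hg) Φ

/-- `‖𝒢ᵀΦ‖₁ = ‖Φ‖₁`. [folklore] -/
theorem l1N_gauge_transpose {g : X → Matrix ι ι ℝ} (hg : IsGauge g) (Φ : X × ι → ℝ) :
    l1N ((blockDiag g)ᵀ *ᵥ Φ) = l1N Φ := by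
  rw [B4GaugeCovariance.blockDiag_transpose]
  exact l1N_gauge (isGauge_transpose hg) Φ

/-- `(𝒢D𝒢ᵀ)(𝒢G₀𝒢ᵀ) = 𝒢 D G₀ 𝒢ᵀ` (`𝒢ᵀ𝒢 = 1`). [folklore] -/
theorem conj_mul_conj {g : X → Matrix ι ι ℝ} (hg : IsGauge g) (D G₀ : Matrix (X × ι) (X × ι) ℝ) :
    blockDiag g * D * (blockDiag g)ᵀ * (blockDiag g * G₀ * (blockDiag g)ᵀ)
      = blockDiag g * (D * (G₀ * (blockDiag g)ᵀ)) := by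
  calc blockDiag g * D * (blockDiag g)ᵀ * (blockDiag g * G₀ * (blockDiag g)ᵀ)
        = blockDiag g * D * ((blockDiag g)ᵀ * blockDiag g) * G₀ * (blockDiag g)ᵀ := by
          simp only [Matrix.mul_assoc]
    _ = blockDiag g * (D * (G₀ * (blockDiag g)ᵀ)) := by
          rw [blockDiag_transpose_mul_self hg, Matrix.mul_one]
          simp only [Matrix.mul_assoc]

/-- **THE GAUGE STEP FOR THE BOOTSTRAP HYPOTHESES** (any nonnegative functional `ν` invariant under `𝒢` and `𝒢ᵀ`):
the (2.17)-type bounds `ν(G₀Φ) ≤ cνΦ`, `ν(D_μG₀Φ) ≤ cνΦ` pass to the gauge conjugates `𝒢G₀𝒢ᵀ`, `𝒢D_μ𝒢ᵀ` with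
the same constant — «Lemma 2.2 in the case of a constant configuration A₀ is equivalent to the case of
configuration A₀ = 0 by the same argument with the gauge transformation».
[cite: Balaban1983RegularityDecay, p. 581] -/
theorem hyps_conj {κ : Type*} {ν : (X × ι → ℝ) → ℝ} {g : X → Matrix ι ι ℝ}
    (hν : ∀ Φ, ν (blockDiag g *ᵥ Φ) = ν Φ) (hνt : ∀ Φ, ν ((blockDiag g)ᵀ *ᵥ Φ) = ν Φ) (hg : IsGauge g)
    {G₀ : Matrix (X × ι) (X × ι) ℝ} {D : κ → Matrix (X × ι) (X × ι) ℝ} {c : ℝ}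
    (h0 : ∀ Φ, ν (G₀ *ᵥ Φ) ≤ c * ν Φ) (hD : ∀ μ Φ, ν (D μ *ᵥ (G₀ *ᵥ Φ)) ≤ c * ν Φ) :
    (∀ Φ, ν ((blockDiag g * G₀ * (blockDiag g)ᵀ) *ᵥ Φ) ≤ c * ν Φ) ∧
    (∀ μ Φ, ν ((blockDiag g * D μ * (blockDiag g)ᵀ) *ᵥ ((blockDiag g * G₀ * (blockDiag g)ᵀ) *ᵥ Φ))
        ≤ c * ν Φ) := by
  refine ⟨fun Φ => ?_, fun μ Φ => ?_⟩
  · rw [← mulVec_mulVec, ← mulVec_mulVec, hν]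
    simpa only [hνt] using h0 ((blockDiag g)ᵀ *ᵥ Φ)
  · rw [mulVec_mulVec, conj_mul_conj hg, ← mulVec_mulVec, ← mulVec_mulVec, ← mulVec_mulVec, hν]
    simpa only [hνt] using hD μ ((blockDiag g)ᵀ *ᵥ Φ)

/-- the `‖·‖_∞` instance of the gauge step. [cite: Balaban1983RegularityDecay, p. 581] -/
theorem sup_hyps_conj {κ : Type*} {g : X → Matrix ι ι ℝ} (hg : IsGauge g)
    {G₀ : Matrix (X × ι) (X × ι) ℝ} {D : κ → Matrix (X × ι) (X × ι) ℝ} {c : ℝ}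
    (h0 : ∀ Φ, supN (G₀ *ᵥ Φ) ≤ c * supN Φ) (hD : ∀ μ Φ, supN (D μ *ᵥ (G₀ *ᵥ Φ)) ≤ c * supN Φ) :
    (∀ Φ, supN ((blockDiag g * G₀ * (blockDiag g)ᵀ) *ᵥ Φ) ≤ c * supN Φ) ∧
    (∀ μ Φ, supN ((blockDiag g * D μ * (blockDiag g)ᵀ) *ᵥ ((blockDiag g * G₀ * (blockDiag g)ᵀ) *ᵥ Φ))
        ≤ c * supN Φ) :=
  hyps_conj (supN_gauge hg) (supN_gauge_transpose hg) hg h0 hD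

/-- the `‖·‖₁` instance of the gauge step. [cite: Balaban1983RegularityDecay, p. 581] -/
theorem l1_hyps_conj {κ : Type*} {g : X → Matrix ι ι ℝ} (hg : IsGauge g)
    {G₀ : Matrix (X × ι) (X × ι) ℝ} {D : κ → Matrix (X × ι) (X × ι) ℝ} {c : ℝ}
    (h0 : ∀ Φ, l1N (G₀ *ᵥ Φ) ≤ c * l1N Φ) (hD : ∀ μ Φ, l1N (D μ *ᵥ (G₀ *ᵥ Φ)) ≤ c * l1N Φ) :
    (∀ Φ, l1N ((blockDiag g * G₀ * (blockDiag g)ᵀ) *ᵥ Φ) ≤ c * l1N Φ) ∧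
    (∀ μ Φ, l1N ((blockDiag g * D μ * (blockDiag g)ᵀ) *ᵥ ((blockDiag g * G₀ * (blockDiag g)ᵀ) *ᵥ Φ))
        ≤ c * l1N Φ) :=
  hyps_conj (l1N_gauge hg) (l1N_gauge_transpose hg) hg h0 hD

end Gauge

/-! ## §6 The covariant derivative at trivial and at pure-gauge link variables; the constant-`A₀` hypotheses -/

section CovDeriv

variable {d : ℕ} {ι : Type} [Fintype ι] [DecidableEq ι]

omit [Fintype ι] in
/-- **`D^η_{0,μ} = D^η_μ ⊗ 1`**: at trivial link variables the covariant derivative (1.3) of the lineage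
(`B4Lemma21Region.covDeriv`) is the colourwise scalar forward difference (`B4Cor23Zero.fdiffM`).
[cite: Balaban1983RegularityDecay, (1.3) p. 572; p. 582 «1 is identity operator on R^N»] -/
theorem covDeriv_one (n : ℕ) (R : Finset (Fin (d + 1) → ℤ)) (μ : Fin (d + 1)) :
    covDeriv n R (fun _ _ => (1 : Matrix ι ι ℝ)) μ = fdiffM n R μ ⊗ₖ (1 : Matrix ι ι ℝ) := by
  rw [covDeriv, ← blockOp_smul_one]
  congr 1
  funext x z
  simp only [dirKer, fdiffM, Matrix.of_apply, e1, uvec]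
  split_ifs <;> simp

/-- the bond kernel of `D^η_{W,μ}` is gauge covariant: `dirKer(gWgᵀ) = g·dirKer(W)·gᵀ` (uses `g(x)g(x)ᵀ = 1` on the
diagonal term). [folklore] -/
theorem dirKer_gaugeKer {n : ℕ} {R : Finset (Fin (d + 1) → ℤ)} {g : ↥R → Matrix ι ι ℝ} (hg : IsGauge g)
    (W : ↥R → ↥R → Matrix ι ι ℝ) (μ : Fin (d + 1)) :
    dirKer n R (gaugeKer g g W) μ = gaugeKer g g (dirKer n R W μ) := by
  funext x z
  by_cases hx : x.1 + e1 μ ∈ R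
  · have hB : g x * (if z = x then (1 : Matrix ι ι ℝ) else 0) * (g z)ᵀ = if z = x then 1 else 0 := by
      split_ifs with h
      · subst h
        rw [Matrix.mul_one, hg.mul_transpose]
      · rw [Matrix.mul_zero, Matrix.zero_mul]
    have hA : g x * (if z.1 = x.1 + e1 μ then W x z else 0) * (g z)ᵀ
        = if z.1 = x.1 + e1 μ then g x * W x z * (g z)ᵀ else 0 := by
      split_ifs
      · rfl
      · rw [Matrix.mul_zero, Matrix.zero_mul]
    simp only [dirKer, gaugeKer_apply, if_pos hx]
    rw [Matrix.mul_smul, Matrix.smul_mul, Matrix.mul_sub, Matrix.sub_mul, hA, hB]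
  · simp only [dirKer, gaugeKer_apply, if_neg hx, Matrix.mul_zero, Matrix.zero_mul]

/-- **GAUGE COVARIANCE OF THE COVARIANT DERIVATIVE**: `D^η_{gWgᵀ,μ} = 𝒢 D^η_{W,μ} 𝒢ᵀ`. [folklore] -/
theorem covDeriv_gauge {n : ℕ} {R : Finset (Fin (d + 1) → ℤ)} {g : ↥R → Matrix ι ι ℝ} (hg : IsGauge g)
    (W : ↥R → ↥R → Matrix ι ι ℝ) (μ : Fin (d + 1)) :
    covDeriv n R (gaugeKer g g W) μ = blockDiag g * covDeriv n R W μ * (blockDiag g)ᵀ := by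
  rw [covDeriv, covDeriv, dirKer_gaugeKer hg, blockOp_gaugeKer]

/-- **THE COVARIANT DERIVATIVE AT A CONSTANT CONFIGURATION IS A GAUGE CONJUGATE OF `D^η_μ ⊗ 1`**:
`D^η_{A₀,μ} = 𝒢 (D^η_μ ⊗ 1) 𝒢ᵀ`, `𝒢 = ⊕_x U(κλ(x))`, `λ = −⟨A₀,·⟩` (`B4GaugeCovariance.fieldLink_constBond`).
[cite: Balaban1983RegularityDecay, p. 581] -/
theorem covDeriv_constBond (F : OrthFlow ι) (κ : ℝ) (n : ℕ) (R : Finset (Fin (d + 1) → ℤ))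
    (A₀ : Fin (d + 1) → ℝ) (pos : ↥R → (Fin (d + 1) → ℤ)) (μ : Fin (d + 1)) :
    covDeriv n R (fieldLink F κ (constBond A₀ pos)) μ
      = blockDiag (fun u => F.U (κ * linGauge A₀ pos u)) * (fdiffM n R μ ⊗ₖ (1 : Matrix ι ι ℝ))
          * (blockDiag fun u => F.U (κ * linGauge A₀ pos u))ᵀ := by
  rw [fieldLink_constBond, covDeriv_gauge (F.isGauge _), covDeriv_one]

variable (d)

/-- **`G_k(□, A₀)`** — [B4]'s Green's function (1.6) of the lineage's operator family (`B4GaugeCovariance.b4Green`)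
on the fine box `□` (bond weights `boxWt`, block weights `blkWt`, running coefficient `a_k`, any contour system
`Γ` ending at the averaged point) at the CONSTANT configuration `A₀` (`constBond A₀`).
[cite: Balaban1983RegularityDecay, (1.6) p. 572; p. 581] -/
abbrev greenA0 (F : OrthFlow ι) (κ : ℝ) (ℓ k : ℕ) (a m2 : ℝ) (M : Fin (d + 1) → ℕ)
    (emb : ↥(boxDom M) → ↥(Box d ℓ k M)) (Γ : ↥(boxDom M) → ↥(Box d ℓ k M) → List ↥(Box d ℓ k M))
    (A₀ : Fin (d + 1) → ℝ) : Matrix (↥(Box d ℓ k M) × ι) (↥(Box d ℓ k M) × ι) ℝ :=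
  b4Green F κ (boxWt ((ℓ + 1) ^ k) (fun i => (ℓ + 1) ^ k * M i)) m2
    (B1.aSeq a ((ℓ : ℝ) + 1) k * (((((ℓ + 1) ^ k : ℕ)) : ℝ) ^ (d + 1))⁻¹)
    (blkWt ((ℓ + 1) ^ k) M (fun i => (ℓ + 1) ^ k * M i)) emb Γ (constBond A₀ Subtype.val)

/-- **`D^η_{A₀,μ}`** on the fine box at the constant configuration. [cite: Balaban1983RegularityDecay, (1.3) p. 572] -/
abbrev derivA0 (F : OrthFlow ι) (κ : ℝ) (ℓ k : ℕ) (M : Fin (d + 1) → ℕ) (A₀ : Fin (d + 1) → ℝ) (μ : Fin (d + 1)) :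
    Matrix (↥(Box d ℓ k M) × ι) (↥(Box d ℓ k M) × ι) ℝ :=
  covDeriv ((ℓ + 1) ^ k) (Box d ℓ k M) (fieldLink F κ (constBond A₀ Subtype.val)) μ

variable {d}

/-- **THE CONSTANT-`A₀` SUP-NORM HYPOTHESES** («Let us assume that Lemma 2.2 holds for G_k(□,A₀) with constant
configurations A₀» — here PROVED for the clauses `q = p = ∞`, `n = 0,1`, on boxes): uniformly over the window,
the box, the contour system and `A₀`, `‖G_k(□,A₀)Φ‖_∞ ≤ c‖Φ‖_∞` and `‖D^η_{A₀,μ}G_k(□,A₀)Φ‖_∞ ≤ c‖Φ‖_∞` — from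
§3 by the gauge step §5 (`B4GaugeCovariance.b4Green_constBond`, `covDeriv_constBond`).
[cite: Balaban1983RegularityDecay, Lemma 2.2 (2.17) p. 578; p. 581] -/
theorem const_box_sup (F : OrthFlow ι) (κ : ℝ) (d ℓ : ℕ) (hℓ : 1 ≤ ℓ) (amin aplus m2plus : ℝ) (ha : 0 < amin) :
    ∃ c : ℝ, 0 < c ∧ ∀ (k : ℕ), 1 ≤ k → ∀ (a m2 : ℝ), amin ≤ a → a ≤ aplus → 0 ≤ m2 → m2 ≤ m2plus →
      ∀ (M : Fin (d + 1) → ℕ), (∀ i, 1 ≤ M i) →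
      ∀ (emb : ↥(boxDom M) → ↥(Box d ℓ k M)) (Γ : ↥(boxDom M) → ↥(Box d ℓ k M) → List ↥(Box d ℓ k M)),
        (∀ y x, blkWt ((ℓ + 1) ^ k) M (fun i => (ℓ + 1) ^ k * M i) y x ≠ 0 → pathEnd (emb y) (Γ y x) = x) →
      ∀ (A₀ : Fin (d + 1) → ℝ),
        (∀ Φ : ↥(Box d ℓ k M) × ι → ℝ,
            supN (greenA0 d F κ ℓ k a m2 M emb Γ A₀ *ᵥ Φ) ≤ c * supN Φ) ∧
        (∀ (μ : Fin (d + 1)) (Φ : ↥(Box d ℓ k M) × ι → ℝ),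
            supN (derivA0 d F κ ℓ k M A₀ μ *ᵥ (greenA0 d F κ ℓ k a m2 M emb Γ A₀ *ᵥ Φ)) ≤ c * supN Φ) := by
  obtain ⟨c, hc, h⟩ := zero_box_sup ι d ℓ hℓ amin aplus m2plus ha
  refine ⟨c, hc, ?_⟩
  intro k hk a m2 e1 e2 e3 e4 M hM emb Γ hend A₀
  obtain ⟨h0, hD⟩ := h k hk a m2 e1 e2 e3 e4 M hM
  have hL : (1 : ℝ) < (ℓ : ℝ) + 1 := by
    have : (1 : ℝ) ≤ (ℓ : ℝ) := by exact_mod_cast hℓ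
    linarith
  have hak : 0 < B1.aSeq a ((ℓ : ℝ) + 1) k := B1.aSeq_pos (lt_of_lt_of_le ha e1) hL hk
  have hn : 1 ≤ (ℓ + 1) ^ k := Nat.one_le_pow _ _ (Nat.succ_pos ℓ)
  have hS : IsUnit (scalarOp (boxWt ((ℓ + 1) ^ k) (fun i => (ℓ + 1) ^ k * M i)) m2
      (B1.aSeq a ((ℓ : ℝ) + 1) k * (((((ℓ + 1) ^ k : ℕ)) : ℝ) ^ (d + 1))⁻¹)
      (blkWt ((ℓ + 1) ^ k) M (fun i => (ℓ + 1) ^ k * M i))).det := by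
    rw [scalarOp_box hn]
    exact boxOpR_det_isUnit hn hak e3 hM
  have hg : IsGauge (fun u : ↥(Box d ℓ k M) => F.U (κ * linGauge A₀ Subtype.val u)) := F.isGauge _
  have hG : greenA0 d F κ ℓ k a m2 M emb Γ A₀
      = blockDiag (fun u : ↥(Box d ℓ k M) => F.U (κ * linGauge A₀ Subtype.val u))
          * (gk d ℓ k a m2 M ⊗ₖ (1 : Matrix ι ι ℝ))
          * (blockDiag fun u : ↥(Box d ℓ k M) => F.U (κ * linGauge A₀ Subtype.val u))ᵀ := by
    dsimp only [greenA0]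
    rw [b4Green_constBond F κ _ m2 _ hend A₀ _ hS, scalarOp_box hn]
  have hDer : ∀ μ, derivA0 d F κ ℓ k M A₀ μ
      = blockDiag (fun u : ↥(Box d ℓ k M) => F.U (κ * linGauge A₀ Subtype.val u))
          * (dk d ℓ k M μ ⊗ₖ (1 : Matrix ι ι ℝ))
          * (blockDiag fun u : ↥(Box d ℓ k M) => F.U (κ * linGauge A₀ Subtype.val u))ᵀ := fun μ => by
    dsimp only [derivA0]
    rw [covDeriv_constBond]
  obtain ⟨c0, cD⟩ := sup_hyps_conj (κ := Fin (d + 1)) (D := fun μ => dk d ℓ k M μ ⊗ₖ (1 : Matrix ι ι ℝ))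
    hg h0 hD
  refine ⟨fun Φ => ?_, fun μ Φ => ?_⟩
  · rw [hG]
    exact c0 Φ
  · rw [hG, hDer μ]
    exact cD μ Φ

/-- **LEMMA 2.2 (2.17), `q = p = ∞`, `n = 0,1`, FOR THE PERTURBED PROPAGATOR AROUND A CONSTANT CONFIGURATION** —
the printed structure of p. 581 with BOTH its inputs kernel-certified on boxes: «Lemma 2.2 holds for G_k(□,A₀) with
constant configurations A₀» (`const_box_sup`) + «V_k … a first order differential operator with small
coefficients» (hypothesis `FirstOrderSmall`, measured with `D^η_{A₀,μ}`) + «for e sufficiently small»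
(`(d+2)cε ≤ 1/2`) ⇒ for every `G` with `G = G_k(□,A₀) + G_k(□,A₀)VG` ((2.26)/(2.31)):
`‖GΦ‖_∞ + Σ_μ‖D^η_{A₀,μ}GΦ‖_∞ ≤ 2(d+2)c‖Φ‖_∞`.
[cite: Balaban1983RegularityDecay, Lemma 2.2 (2.17) p. 578; proof p. 581 (2.31)–(2.33)] -/
theorem lemma22_17_sup_const (F : OrthFlow ι) (κ : ℝ) (d ℓ : ℕ) (hℓ : 1 ≤ ℓ) (amin aplus m2plus : ℝ)
    (ha : 0 < amin) :
    ∃ c : ℝ, 0 < c ∧ ∀ (k : ℕ), 1 ≤ k → ∀ (a m2 : ℝ), amin ≤ a → a ≤ aplus → 0 ≤ m2 → m2 ≤ m2plus →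
      ∀ (M : Fin (d + 1) → ℕ), (∀ i, 1 ≤ M i) →
      ∀ (emb : ↥(boxDom M) → ↥(Box d ℓ k M)) (Γ : ↥(boxDom M) → ↥(Box d ℓ k M) → List ↥(Box d ℓ k M)),
        (∀ y x, blkWt ((ℓ + 1) ^ k) M (fun i => (ℓ + 1) ^ k * M i) y x ≠ 0 → pathEnd (emb y) (Γ y x) = x) →
      ∀ (A₀ : Fin (d + 1) → ℝ) (V G : Matrix (↥(Box d ℓ k M) × ι) (↥(Box d ℓ k M) × ι) ℝ) (ε : ℝ),
        G = greenA0 d F κ ℓ k a m2 M emb Γ A₀ + greenA0 d F κ ℓ k a m2 M emb Γ A₀ * V * G →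
        FirstOrderSmall supN V (derivA0 d F κ ℓ k M A₀) ε →
        ((d : ℝ) + 2) * c * ε ≤ 1 / 2 →
        ∀ Φ : ↥(Box d ℓ k M) × ι → ℝ,
          supN (G *ᵥ Φ) + ∑ μ, supN (derivA0 d F κ ℓ k M A₀ μ *ᵥ (G *ᵥ Φ))
            ≤ 2 * (((d : ℝ) + 2) * c) * supN Φ := by
  obtain ⟨c, hc, h⟩ := const_box_sup F κ d ℓ hℓ amin aplus m2plus ha
  refine ⟨c, hc, ?_⟩
  intro k hk a m2 e1 e2 e3 e4 M hM emb Γ hend A₀ V G ε hres hV hsm Φ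
  obtain ⟨h0, hD⟩ := h k hk a m2 e1 e2 e3 e4 M hM emb Γ hend A₀
  have key := reduce_sup (κ := Fin (d + 1)) hres hc.le h0 hD hV (by rw [card_dir_add_one]; exact hsm) Φ
  rw [card_dir_add_one] at key
  exact key

/-- the (2.33)/(2.16)-shape transfer around a constant configuration: a subadditive `N` with
`N(G_k(□,A₀)Φ) ≤ c₁‖Φ‖_∞` satisfies `N(GΦ) ≤ 2c₁‖Φ‖_∞`.
[cite: Balaban1983RegularityDecay, (2.33) p. 581; Lemma 2.2 (2.16) p. 578] -/
theorem lemma22_16_transfer_const (F : OrthFlow ι) (κ : ℝ) (d ℓ : ℕ) (hℓ : 1 ≤ ℓ) (amin aplus m2plus : ℝ)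
    (ha : 0 < amin) :
    ∃ c : ℝ, 0 < c ∧ ∀ (k : ℕ), 1 ≤ k → ∀ (a m2 : ℝ), amin ≤ a → a ≤ aplus → 0 ≤ m2 → m2 ≤ m2plus →
      ∀ (M : Fin (d + 1) → ℕ), (∀ i, 1 ≤ M i) →
      ∀ (emb : ↥(boxDom M) → ↥(Box d ℓ k M)) (Γ : ↥(boxDom M) → ↥(Box d ℓ k M) → List ↥(Box d ℓ k M)),
        (∀ y x, blkWt ((ℓ + 1) ^ k) M (fun i => (ℓ + 1) ^ k * M i) y x ≠ 0 → pathEnd (emb y) (Γ y x) = x) →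
      ∀ (A₀ : Fin (d + 1) → ℝ) (V G : Matrix (↥(Box d ℓ k M) × ι) (↥(Box d ℓ k M) × ι) ℝ) (ε : ℝ),
        G = greenA0 d F κ ℓ k a m2 M emb Γ A₀ + greenA0 d F κ ℓ k a m2 M emb Γ A₀ * V * G →
        FirstOrderSmall supN V (derivA0 d F κ ℓ k M A₀) ε → 0 ≤ ε →
        ((d : ℝ) + 2) * c * ε ≤ 1 / 2 →
        ∀ (N : (↥(Box d ℓ k M) × ι → ℝ) → ℝ), (∀ Φ Ψ, N (Φ + Ψ) ≤ N Φ + N Ψ) →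
        ∀ (c₁ : ℝ), 0 ≤ c₁ → (∀ Φ, N (greenA0 d F κ ℓ k a m2 M emb Γ A₀ *ᵥ Φ) ≤ c₁ * supN Φ) →
        ∀ Φ : ↥(Box d ℓ k M) × ι → ℝ, N (G *ᵥ Φ) ≤ 2 * c₁ * supN Φ := by
  obtain ⟨c, hc, h⟩ := const_box_sup F κ d ℓ hℓ amin aplus m2plus ha
  refine ⟨c, hc, ?_⟩
  intro k hk a m2 e1 e2 e3 e4 M hM emb Γ hend A₀ V G ε hres hV hε hsm N hNadd c₁ hc₁ hN0 Φ
  obtain ⟨h0, hD⟩ := h k hk a m2 e1 e2 e3 e4 M hM emb Γ hend A₀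
  exact transfer (κ := Fin (d + 1)) supN_nonneg supN_add_le hres hc.le hε h0 hD hV
    (by rw [card_dir_add_one]; exact hsm) hNadd hc₁ hN0 Φ

end CovDeriv

/-! ## §7 THE FIELD `Ã = A₀ + A′` — [B4]'s `G_k(□,Ã)` as the resolvent of `H(A₀) − V`, `V = −vOp` ((2.24)/(2.31)) -/

section Field

variable {d : ℕ} {ι : Type} [Fintype ι] [DecidableEq ι]

/-- a gauge conjugate of an invertible block operator is invertible. [folklore] -/
theorem conj_isUnit_det {X : Type*} [Fintype X] [DecidableEq X] {g : X → Matrix ι ι ℝ} (hg : IsGauge g)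
    {T : Matrix (X × ι) (X × ι) ℝ} (h : IsUnit T.det) :
    IsUnit (blockDiag g * T * (blockDiag g)ᵀ).det := by
  rw [det_mul, det_mul]
  exact ((Matrix.isUnit_det_of_left_inverse (blockDiag_transpose_mul_self hg)).mul h).mul
    (Matrix.isUnit_det_of_left_inverse (blockDiag_mul_transpose_self hg))

variable (d)

/-- **`H(□, A) = −Δ^{η,N}_{A,□} + m² + a_kP_k(A)`** — [B4]'s operator (1.6) of the lineage (`B4GaugeCovariance.b4Op`)
on the fine box, for an ARBITRARY vector field `A` (bond function). [cite: Balaban1983RegularityDecay, (1.6) p. 572] -/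
abbrev opA (F : OrthFlow ι) (κ : ℝ) (ℓ k : ℕ) (a m2 : ℝ) (M : Fin (d + 1) → ℕ)
    (emb : ↥(boxDom M) → ↥(Box d ℓ k M)) (Γ : ↥(boxDom M) → ↥(Box d ℓ k M) → List ↥(Box d ℓ k M))
    (A : ↥(Box d ℓ k M) → ↥(Box d ℓ k M) → ℝ) : Matrix (↥(Box d ℓ k M) × ι) (↥(Box d ℓ k M) × ι) ℝ :=
  b4Op F κ (boxWt ((ℓ + 1) ^ k) (fun i => (ℓ + 1) ^ k * M i)) m2
    (B1.aSeq a ((ℓ : ℝ) + 1) k * (((((ℓ + 1) ^ k : ℕ)) : ℝ) ^ (d + 1))⁻¹)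
    (blkWt ((ℓ + 1) ^ k) M (fun i => (ℓ + 1) ^ k * M i)) emb Γ A

/-- **`G_k(□, A)`** for an arbitrary vector field `A` (`B4GaugeCovariance.b4Green` on the fine box).
[cite: Balaban1983RegularityDecay, (1.6) p. 572] -/
abbrev greenA (F : OrthFlow ι) (κ : ℝ) (ℓ k : ℕ) (a m2 : ℝ) (M : Fin (d + 1) → ℕ)
    (emb : ↥(boxDom M) → ↥(Box d ℓ k M)) (Γ : ↥(boxDom M) → ↥(Box d ℓ k M) → List ↥(Box d ℓ k M))
    (A : ↥(Box d ℓ k M) → ↥(Box d ℓ k M) → ℝ) : Matrix (↥(Box d ℓ k M) × ι) (↥(Box d ℓ k M) × ι) ℝ :=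
  b4Green F κ (boxWt ((ℓ + 1) ^ k) (fun i => (ℓ + 1) ^ k * M i)) m2
    (B1.aSeq a ((ℓ : ℝ) + 1) k * (((((ℓ + 1) ^ k : ℕ)) : ℝ) ^ (d + 1))⁻¹)
    (blkWt ((ℓ + 1) ^ k) M (fun i => (ℓ + 1) ^ k * M i)) emb Γ A

/-- **[B4]'s PERTURBATION `V` OF (2.24)/(2.31) AS AN OPERATOR**: `V = −vOp`, the lineage's typed form
(`B4Lower18Regular.vOp`, `b4Op_add`) of `−[F₁^*D_{A₀} + D^*_{A₀}F₁ − F₁^*F₁ − a_kF₂^*Q_k(A₀) − a_kQ_k^*(A₀)F₂ −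
a_kF₂^*F₂]` for `Ã = A₀ + A′`, so that `H(□,Ã) = H(□,A₀) − V`.
[cite: Balaban1983RegularityDecay, (2.24)–(2.25) p. 580, (2.31)–(2.32) p. 581] -/
abbrev pertV (F : OrthFlow ι) (κ : ℝ) (ℓ k : ℕ) (a : ℝ) (M : Fin (d + 1) → ℕ)
    (emb : ↥(boxDom M) → ↥(Box d ℓ k M)) (Γ : ↥(boxDom M) → ↥(Box d ℓ k M) → List ↥(Box d ℓ k M))
    (A₀ : Fin (d + 1) → ℝ) (A' : ↥(Box d ℓ k M) → ↥(Box d ℓ k M) → ℝ) :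
    Matrix (↥(Box d ℓ k M) × ι) (↥(Box d ℓ k M) × ι) ℝ :=
  -vOp (boxWt ((ℓ + 1) ^ k) (fun i => (ℓ + 1) ^ k * M i))
    (B1.aSeq a ((ℓ : ℝ) + 1) k * (((((ℓ + 1) ^ k : ℕ)) : ℝ) ^ (d + 1))⁻¹)
    (blkWt ((ℓ + 1) ^ k) M (fun i => (ℓ + 1) ^ k * M i)) (fieldLink F κ A')
    (fieldLink F κ (constBond A₀ Subtype.val)) (contourTrans (fieldLink F κ A') emb Γ)
    (contourTrans (fieldLink F κ (constBond A₀ Subtype.val)) emb Γ)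

/-- **`D^η_{Ã,μ}`** on the fine box at an arbitrary field. [cite: Balaban1983RegularityDecay, (1.3) p. 572] -/
abbrev derivA (F : OrthFlow ι) (κ : ℝ) (ℓ k : ℕ) (M : Fin (d + 1) → ℕ)
    (A : ↥(Box d ℓ k M) → ↥(Box d ℓ k M) → ℝ) (μ : Fin (d + 1)) :
    Matrix (↥(Box d ℓ k M) × ι) (↥(Box d ℓ k M) × ι) ℝ :=
  covDeriv ((ℓ + 1) ^ k) (Box d ℓ k M) (fieldLink F κ A) μ

variable {d}

/-- `H(□, A₀)` is invertible on the window (gauge conjugate of `H_k(□) ⊗ 1`, `B4BoxCov237.boxOpR_det_isUnit`).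
[cite: Balaban1983RegularityDecay, p. 581] -/
theorem opA_constBond_isUnit_det (F : OrthFlow ι) (κ : ℝ) {ℓ k : ℕ} (hℓ : 1 ≤ ℓ) (hk : 1 ≤ k) {a m2 : ℝ}
    (ha : 0 < a)
    (hm : 0 ≤ m2) {M : Fin (d + 1) → ℕ} (hM : ∀ i, 1 ≤ M i) {emb : ↥(boxDom M) → ↥(Box d ℓ k M)}
    {Γ : ↥(boxDom M) → ↥(Box d ℓ k M) → List ↥(Box d ℓ k M)}
    (hend : ∀ y x, blkWt ((ℓ + 1) ^ k) M (fun i => (ℓ + 1) ^ k * M i) y x ≠ 0 → pathEnd (emb y) (Γ y x) = x)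
    (A₀ : Fin (d + 1) → ℝ) :
    IsUnit (opA d F κ ℓ k a m2 M emb Γ (constBond A₀ Subtype.val)).det := by
  have hL : (1 : ℝ) < (ℓ : ℝ) + 1 := by
    have : (1 : ℝ) ≤ (ℓ : ℝ) := by exact_mod_cast hℓ
    linarith
  have hak : 0 < B1.aSeq a ((ℓ : ℝ) + 1) k := B1.aSeq_pos ha hL hk
  have hn : 1 ≤ (ℓ + 1) ^ k := Nat.one_le_pow _ _ (Nat.succ_pos ℓ)
  dsimp only [opA]
  rw [b4Op_constBond F κ _ m2 _ hend A₀ _, scalarOp_box hn]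
  exact conj_isUnit_det (F.isGauge _) (kron_one_isUnit_det (boxOpR_det_isUnit hn hak hm hM))

/-- **(2.31) FOR [B4]'s GREEN'S FUNCTION**: `G_k(□,Ã) = G_k(□,A₀) + G_k(□,A₀) V G_k(□,Ã)`, `Ã = A₀ + A′`, `V = −vOp` —
the second resolvent identity (`B4Lower18Regular.inv_sub_eq`) on `H(□,Ã) = H(□,A₀) − V` (`b4Op_add`); the
invertibility of `H(□,Ã)` is a hypothesis (on the window with the staircase contours and (1.7)-regular `Ã` it is
`B4Lower18Regular.green_box_l2_bound`). [cite: Balaban1983RegularityDecay, (2.31) p. 581; (2.24) p. 580] -/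
theorem greenA_resolvent (F : OrthFlow ι) (κ : ℝ) {ℓ k : ℕ} (hℓ : 1 ≤ ℓ) (hk : 1 ≤ k) {a m2 : ℝ} (ha : 0 < a)
    (hm : 0 ≤ m2) {M : Fin (d + 1) → ℕ} (hM : ∀ i, 1 ≤ M i) {emb : ↥(boxDom M) → ↥(Box d ℓ k M)}
    {Γ : ↥(boxDom M) → ↥(Box d ℓ k M) → List ↥(Box d ℓ k M)}
    (hend : ∀ y x, blkWt ((ℓ + 1) ^ k) M (fun i => (ℓ + 1) ^ k * M i) y x ≠ 0 → pathEnd (emb y) (Γ y x) = x)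
    (A₀ : Fin (d + 1) → ℝ) {A' : ↥(Box d ℓ k M) → ↥(Box d ℓ k M) → ℝ}
    (hunit : IsUnit (opA d F κ ℓ k a m2 M emb Γ (constBond A₀ Subtype.val + A')).det) :
    greenA d F κ ℓ k a m2 M emb Γ (constBond A₀ Subtype.val + A')
      = greenA0 d F κ ℓ k a m2 M emb Γ A₀
        + greenA0 d F κ ℓ k a m2 M emb Γ A₀ * pertV d F κ ℓ k a M emb Γ A₀ A'
          * greenA d F κ ℓ k a m2 M emb Γ (constBond A₀ Subtype.val + A') := by
  have h₀ := opA_constBond_isUnit_det F κ hℓ hk ha hm hM hend A₀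
  dsimp only [greenA, greenA0, pertV, opA] at hunit h₀ ⊢
  rw [b4Green, b4Green, b4Op_add] at *
  rw [← sub_neg_eq_add] at hunit ⊢
  exact inv_sub_eq h₀ hunit

/-- **LEMMA 2.2 (2.17), `q = p = ∞`, `n = 0,1`, FOR [B4]'s `G_k(□,Ã)` ITSELF, ONE HYPOTHESIS AWAY** — the printed
proof structure of p. 581 with every input but one in kernel form: for `Ã = A₀ + A′` on a fine box, IF `H(□,Ã)` is
invertible and [B4]'s perturbation `V` (`pertV`) is first-order small in `‖·‖_∞` w.r.t. `D^η_{A₀,μ}` with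
`(d+2)cε ≤ 1/2` («V_k … a first order differential operator with small coefficients … for e sufficiently small» —
the content of (2.25)/(2.32) under (1.7), NOT certified here), THEN
`‖G_k(□,Ã)Φ‖_∞ + Σ_μ‖D^η_{A₀,μ}G_k(□,Ã)Φ‖_∞ ≤ 2(d+2)c‖Φ‖_∞`, `c` uniform over the window, the box, the contour
system, `A₀` and `A′`. [cite: Balaban1983RegularityDecay, Lemma 2.2 (2.17) p. 578; proof p. 581 (2.31)–(2.33)] -/
theorem lemma22_17_sup_field (F : OrthFlow ι) (κ : ℝ) (d ℓ : ℕ) (hℓ : 1 ≤ ℓ) (amin aplus m2plus : ℝ)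
    (ha : 0 < amin) :
    ∃ c : ℝ, 0 < c ∧ ∀ (k : ℕ), 1 ≤ k → ∀ (a m2 : ℝ), amin ≤ a → a ≤ aplus → 0 ≤ m2 → m2 ≤ m2plus →
      ∀ (M : Fin (d + 1) → ℕ), (∀ i, 1 ≤ M i) →
      ∀ (emb : ↥(boxDom M) → ↥(Box d ℓ k M)) (Γ : ↥(boxDom M) → ↥(Box d ℓ k M) → List ↥(Box d ℓ k M)),
        (∀ y x, blkWt ((ℓ + 1) ^ k) M (fun i => (ℓ + 1) ^ k * M i) y x ≠ 0 → pathEnd (emb y) (Γ y x) = x) →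
      ∀ (A₀ : Fin (d + 1) → ℝ) (A' : ↥(Box d ℓ k M) → ↥(Box d ℓ k M) → ℝ) (ε : ℝ),
        IsUnit (opA d F κ ℓ k a m2 M emb Γ (constBond A₀ Subtype.val + A')).det →
        FirstOrderSmall supN (pertV d F κ ℓ k a M emb Γ A₀ A') (derivA0 d F κ ℓ k M A₀) ε →
        ((d : ℝ) + 2) * c * ε ≤ 1 / 2 →
        ∀ Φ : ↥(Box d ℓ k M) × ι → ℝ,
          supN (greenA d F κ ℓ k a m2 M emb Γ (constBond A₀ Subtype.val + A') *ᵥ Φ)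
            + ∑ μ, supN (derivA0 d F κ ℓ k M A₀ μ
                *ᵥ (greenA d F κ ℓ k a m2 M emb Γ (constBond A₀ Subtype.val + A') *ᵥ Φ))
            ≤ 2 * (((d : ℝ) + 2) * c) * supN Φ := by
  obtain ⟨c, hc, h⟩ := const_box_sup F κ d ℓ hℓ amin aplus m2plus ha
  refine ⟨c, hc, ?_⟩
  intro k hk a m2 e1 e2 e3 e4 M hM emb Γ hend A₀ A' ε hunit hV hsm Φ
  obtain ⟨h0, hD⟩ := h k hk a m2 e1 e2 e3 e4 M hM emb Γ hend A₀
  have hres := greenA_resolvent F κ hℓ hk (lt_of_lt_of_le ha e1) e3 hM hend A₀ hunit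
  have key := reduce_sup (κ := Fin (d + 1)) hres hc.le h0 hD hV (by rw [card_dir_add_one]; exact hsm) Φ
  rw [card_dir_add_one] at key
  exact key

/-- **THE `D_Ã`-FOR-`D_{A₀}` CONVERSION OF p. 581.**  Print, p. 581: «Now using Lemma 2.2 for G_k(□,A₀) and the
decomposition D^η_Ã = U(A')D^η_{A₀} + F_{1,k}(A'), we have» [(2.33)], and, after (2.32), «Only here we needed the
assumption that Ã is constant in a neighbourhood of ∂□.»  Reading (ours, not a quotation): the norms of Lemma 2.2
taken with `D_{A₀}` instead of `D_Ã` are interchangeable because `D^η_Ã − U(A')D^η_{A₀} = F_{1,k}(A')` is small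
under (2.23).  Kernel form: if moreover `D^η_{Ã,μ} − D^η_{A₀,μ}` is `φ`-small of first order w.r.t. `D^η_{A₀}`,
then `‖D^η_{Ã,μ}G_k(□,Ã)Φ‖_∞ ≤ (1+φ)·2(d+2)c‖Φ‖_∞` (`B4Lemma22Reduce231.deriv_convert`).
[cite: Balaban1983RegularityDecay, p. 581 (2.32)–(2.33); Lemma 2.2 (2.17) p. 578] -/
theorem lemma22_17_sup_field_deriv (F : OrthFlow ι) (κ : ℝ) (d ℓ : ℕ) (hℓ : 1 ≤ ℓ) (amin aplus m2plus : ℝ)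
    (ha : 0 < amin) :
    ∃ c : ℝ, 0 < c ∧ ∀ (k : ℕ), 1 ≤ k → ∀ (a m2 : ℝ), amin ≤ a → a ≤ aplus → 0 ≤ m2 → m2 ≤ m2plus →
      ∀ (M : Fin (d + 1) → ℕ), (∀ i, 1 ≤ M i) →
      ∀ (emb : ↥(boxDom M) → ↥(Box d ℓ k M)) (Γ : ↥(boxDom M) → ↥(Box d ℓ k M) → List ↥(Box d ℓ k M)),
        (∀ y x, blkWt ((ℓ + 1) ^ k) M (fun i => (ℓ + 1) ^ k * M i) y x ≠ 0 → pathEnd (emb y) (Γ y x) = x) →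
      ∀ (A₀ : Fin (d + 1) → ℝ) (A' : ↥(Box d ℓ k M) → ↥(Box d ℓ k M) → ℝ) (ε φ : ℝ),
        IsUnit (opA d F κ ℓ k a m2 M emb Γ (constBond A₀ Subtype.val + A')).det →
        FirstOrderSmall supN (pertV d F κ ℓ k a M emb Γ A₀ A') (derivA0 d F κ ℓ k M A₀) ε →
        ((d : ℝ) + 2) * c * ε ≤ 1 / 2 → 0 ≤ φ →
        (∀ (μ : Fin (d + 1)) (u : ↥(Box d ℓ k M) × ι → ℝ),
            supN ((derivA d F κ ℓ k M (constBond A₀ Subtype.val + A') μ - derivA0 d F κ ℓ k M A₀ μ) *ᵥ u)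
              ≤ φ * (supN u + ∑ ν', supN (derivA0 d F κ ℓ k M A₀ ν' *ᵥ u))) →
        ∀ (μ : Fin (d + 1)) (Φ : ↥(Box d ℓ k M) × ι → ℝ),
          supN (derivA d F κ ℓ k M (constBond A₀ Subtype.val + A') μ
              *ᵥ (greenA d F κ ℓ k a m2 M emb Γ (constBond A₀ Subtype.val + A') *ᵥ Φ))
            ≤ (1 + φ) * (2 * (((d : ℝ) + 2) * c)) * supN Φ := by
  obtain ⟨c, hc, h⟩ := const_box_sup F κ d ℓ hℓ amin aplus m2plus ha
  refine ⟨c, hc, ?_⟩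
  intro k hk a m2 e1 e2 e3 e4 M hM emb Γ hend A₀ A' ε φ hunit hV hsm hφ hD' μ Φ
  obtain ⟨h0, hD⟩ := h k hk a m2 e1 e2 e3 e4 M hM emb Γ hend A₀
  have hres := greenA_resolvent F κ hℓ hk (lt_of_lt_of_le ha e1) e3 hM hend A₀ hunit
  have key := deriv_convert (κ := Fin (d + 1)) supN_nonneg supN_add_le hres hc.le h0 hD hV
    (by rw [card_dir_add_one]; exact hsm) hφ hD' μ Φ
  rw [card_dir_add_one] at key
  exact key

end Field

end

end Literature.MathematicalPhysics.QuantumFieldTheory.Balaban1983to89.B4Lemma22ReduceZero
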